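import Summits.FinalStateConjecture.FinalStateConjecture.Theses.StarvedNecks
import Summits.FinalStateConjecture.FinalStateConjecture.Theorems.SeamedChartsExhaust.Negative.ReversedFlatChart
import Literature.Geometry.Lorentzian.MinkowskiGlobalHyperbolicity
import Literature.Geometry.Lorentzian.KerrConvergenceProofs
import Literature.Geometry.Lorentzian.CausalFutureProofs
import Literature.Geometry.Lorentzian.CausalityPushUp
import HarnessLib.Audit

/-!
# Line `wide-anchoring` (generation 2) — crux `SeamedChartsExhaust`
# (stmt-FinalStateConjecture-13551, route `StarvedNecks`, rank 4)

Checked skeleton, second generation. The line: the anchoring clause `Hc` (b) of HonestCore is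
quantified over EVERY radius `ϱ ≥ R₀`, so at the `τ₁`-dependent radius `ϱ := Rᵢ(τ₁)`, `τ₂ := τ₁`
it puts the whole sub-slab part `Ψᵢ''{τ₀ < t*ᵢ < τ₁, rᵢ < Rᵢ(τ₁)}` of every hole tube into
`J⁻(certifiedSlab d R τ₁)` — the disc of (b) IS the hole part of the certified slab
(`wideAnchoring`, proved); every other hole-charted point outside the certified late region is a
flat-late point in the same coordinates (collar: clock lag (9) + margin (8) + disjointness (12) ⇒
one atlas (6); far leaf: (10)) or a disc point — so the hole side of REACH is LOOKUP and case
routing (`chartedReach_of_flatBoarding`, proved). Generation 1 of this line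
(planner-cruxplan-stmt-FinalStateConjecture-13551-wide-anchoring-0, commit 3381336e04b6) left two
bundle-form stubs BOARD (flat point ↦ `J⁻(certified slab)`) and FRONTIER (`(closure F ∩ O) \ F ⊆
J⁻(slab)`). Generation 2 was planned with the two sibling skeletons in view (`Lines/rim-criterion.lean`,
`Lines/abstract-exterior.lean`, which generation 1 could not see) and CONSOLIDATES: it proves every
chart-bookkeeping step that any of the three lines leaves open EXCEPT the two irreducible kernels,
which become the registered stubs, each stated SELF-CONTAINED over tree declarations with the
MINIMAL clause set it consumes (no skeleton-local definition occurs in a stub signature, so a stub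
lands under `Theorems/` verbatim and its clause ledger is machine-visible):

* `stub_firstContact` (HARDEST; the one followed flow of the whole crux and the ONLY consumer of
  the load-bearing clause `Hc` (d)): for a flat-late `y`, `τ₀ < y⁰ ≤ τ₁`, the lab ray
  `σ ↦ Φ(y + σ e₀)` EITHER reaches the flat slab `{x⁰ = τ₁}` inside the flat domain `U` (so
  `Φ y ∈ J⁻(Φ(flat slab))`), OR it makes FIRST CONTACT with the closed set `⋃ₖ {rₖ ≤ Rₖ(tₖ)}` at a
  point `c ∈ U` with `τ₀ < c⁰ ≤ τ₁`, `rₖ(c) ≤ Rₖ(tₖ c)` and `Φ y ≤ Φ c`. Clauses: `Hc` (d), SEAMED (1)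
  (continuity of `Rₖ` only), SEAMED (8), the structure field `setOf_lt_excision_subset_flatDomain`.
  No chart switch, no ride, no `R₀`: those are PROVED here (`contact_mem_rideable`, `tubeRide`).
  Same mathematical content as `abstract-exterior`'s `stub_firstContact`, with three clause
  hypotheses instead of the two bundles (so strictly stronger: a proof of this stub proves that one).
* `stub_rim` (the COVER half, causal-content-FREE: pure closure bookkeeping): every point of `O` in
  `closure (certifiedLate d R τ₁)` but not in `certifiedLate d R τ₁` lies on `certifiedSlab d R τ₁`
  or is a RIDE-ABLE certified tube point (`(τ₀ ≤ t ∨ τ₀ ≤ x⁰) ∧ R₀ ≤ r ≤ R(t) ∧ t ≤ τ₁`). Clauses: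
  `Hc` (c), SEAMED (1) (continuity of `R`, `R₀ ≤ ρ`), (8), (11). Stated VERBATIM as
  `Lines/rim-criterion.lean`'s `stub_rim` (planner-cruxplan-…-rim-criterion-0), so ONE proof serves
  both lines; the ride that drains the landing set is PROVED here (`tubeRide`), which turns it into
  generation 1's / `abstract-exterior`'s `FrontierBelowSlab` (`frontierBelowSlab_of_rim`, proved).

`SeamedChartsExhaust_of : stub_firstContact → stub_rim → StarvedNecks.SeamedChartsExhaust`
(kernel-checked, no `sorry`) composes: ride (`tubeRide`) + boarding at the contact point
(`contact_mem_rideable`) turn FIRST CONTACT into BOARD (`flatBoarding_of_firstContact`); wide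
anchoring + routing turn BOARD into REACH (`chartedReach_of_flatBoarding`); ride turns RIM into
FRONTIER; `exteriorOf` is cofinal under the charts and causally convex
(`exteriorOf_causallyConvex`); the certified late region is open (`certifiedLateIsOpen_holds`);
the abstract first-entry covering lemma (`firstEntryCovering`) yields clause (ii) of
`HasExhaustiveCharts d`, and clause (i) is SEAMED (2) with the given radii `R`.

After this file the union of the three passing lines leaves EXACTLY these two stubs open:
rim-criterion's `stub_tubeRide` and `stub_holeRouting` are proved here (`tubeRide`,
`chartedReach_of_flatBoarding`), its `stub_flatBoarding` follows from `stub_firstContact`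
(`flatBoarding_of_firstContact`), abstract-exterior's `stub_frontier` follows from `stub_rim`
(`frontierBelowSlab_of_rim`).

## Disproof / negatives honoured (Disproof.lean v2.2, RESISTS; landed `Theorems/SeamedChartsExhaust/Negative/*`)

* `Negative/WithoutFutureOrientation.lean` (`not_forall_hasExhaustiveCharts_without_futureOrientation`,
  p73931) with its model `Negative/ReversedFlatChart.lean` (`ReversedModel.decomp`,
  `ReversedModel.not_hasExhaustiveCharts_decomp`, p73375; IMPORTED and name-checked below): `Hc` (d)
  is load-bearing. This line consumes (d) at `stub_firstContact` and nowhere else, and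
  `stub_firstContact_false_without_hd` PROVES, against the landed model, that the stub's statement
  with (d) deleted is false — so the stub is not an instance of the refuted (d)-less statement and
  (d) sits exactly where the disprover says it must. `stub_rim` holds in that model (`rim_N0`).
* `Negative/NoHoleCase.lean` (`line_mem_causalFuture`, `hasExhaustiveCharts_of_N_eq_zero`, p74470):
  the flow adapter is reproduced verbatim below (attributed; that module and
  `WithoutFutureOrientation` were accepted but not yet built on the farm when this file was
  checked — swap `line_mem_causalFuture` for the landed `Negative.line_mem_causalFuture` once it is);
  the `N = 0` case is re-proved here at STUB level (`firstContact_N0`, `rim_N0`: both registered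
  signatures hold with no hole in every spacetime), consistent with "a counterexample needs `N ≥ 1`".
* Disproof §2 (decorative hypotheses): consistent — nothing below uses vacuum / maximality /
  admissibility / sub-extremality / SEAMED (2) beyond clause (i) / (3) / (4); `100 Mᵢ ≤ R₀` is used
  only as `r₊ < R₀` in `contact_mem_rideable`. Clause ledger of this file = the disprover's:
  (a)-orthochronous + `r₊ < R₀`; (b) `wideAnchoring`; (c) `stub_rim`; (d) `stub_firstContact`;
  (1), (5)–(12) as listed per lemma. `ledger negatives --problem FinalStateConjecture`: 0 (2026-08-16).

## Triage answers (TRIAGE-r1-1/2/3: pass ×3 for this idea)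

(1) first contact with the CLOSED `⋃ₖ{rₖ ≤ Rₖ(tₖ)}` instead of "a collar short of the wall": it is
the stub itself (ρ-free); (2) hole-early hop = ride: ONE lemma `tubeRide` with the flat-late
disjunct of (5), proved; (3) the edge `r = R(τ₁)`, `t < τ₁` is routed, not anchored (proved routing);
(4) REACH/FRONTIER identifications across cards: this file's stubs imply every sibling stub (above);
(5) "file the two adapters first": `line_mem_causalFuture` is in the file; the first-contact infimum
IS `stub_firstContact`'s content.

References: B. O'Neill, *Semi-Riemannian geometry*, Academic Press 1983, Ch. 14, pp. 402–403
[ONeill1983]; M. Dafermos, G. Holzegel, I. Rodnianski, M. Taylor, arXiv:2104.08222, §1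
[arXiv210408222]; E. Minguzzi, Living Rev. Relativ. 22 (2019) 3 = arXiv:1709.06494, §2 [arXiv170906494].
-/

noncomputable section

set_option linter.dupNamespace false

open Set Filter Topology Function TopologicalSpace
open scoped Manifold ContDiff ENNReal Topology
open Literature.Geometry.Lorentzian

namespace Summit.FinalStateConjecture.FinalStateConjecture.Cruxes.SeamedChartsExhaust.WideAnchoring

/-! ## §0 The crux's let-bound hypothesis bundles, verbatim, and the read-back -/

/-- HonestCore `Hc(𝓢, O, k, d, R₀)` — verbatim copy of the `let`-bound `Hc` of the route decl
`StarvedNecks.SeamedChartsExhaust`: (a) sub-extremal holes, `100 Mᵢ ≤ R₀`, orthochronous boosts;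
(b) ANCHORING at every radius `ϱ ≥ R₀`; (c) relative closedness of late tube portions in `O`;
(d) future-oriented flat chart. -/
def Hc (𝓢 : Spacetime.{0} 4) (O : Set 𝓢.carrier) (k : ℕ) (d : FinalStateDecomposition 𝓢 O k)
    (R₀ : ℝ) : Prop :=
  let B := d.background; let t := fun i ↦ (B i).time; let r := fun i ↦ (B i).radius; let Ψ := d.chart;
  (∀ i, Kerr.IsSubextremal (d.mass i) (d.spin i) ∧ 100 * d.mass i ≤ R₀ ∧
      0 < ((d.motion i).1 : E4 ≃L[ℝ] E4) (E4.basisVector 0) 0) ∧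
  (∀ i (ϱ τ₂ : ℝ), R₀ ≤ ϱ → d.τ₀ < τ₂ →
      Ψ i '' {x | d.τ₀ < t i x.1 ∧ t i x.1 < τ₂ ∧ r i x.1 < ϱ} ⊆
        𝓢.metric.causalPast 𝓢.timeOrientation (Ψ i '' (B i).truncTimeSlab ϱ τ₂)) ∧
  (∀ i (τ' : ℝ) (ϱ : ℝ → ℝ), Continuous ϱ → d.τ₀ < τ' →
      let A := Ψ i '' {x | τ' ≤ t i x.1 ∧ r i x.1 ≤ ϱ (t i x.1)}; closure A ∩ O ⊆ A) ∧
  (∀ y : d.flatDomain, d.τ₀ < y.1 0 →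
      𝓢.timeOrientation.IsFutureDirected (mfderiv 𝓘(ℝ, E4) (𝓡 4) d.flatChart y (E4.basisVector 0)))

/-- SEAMED `Sm(𝓢, O, d, R, R₀)` — verbatim copy of the `let`-bound `Sm` of the route decl (twelve
conjuncts (1)–(12): radii; certification (i); flat/hole `C⁰` thresholds; hole time-lines future
directed on certified tubes; one atlas; flat-late domain = tube complement; flat tubes deep inside
certified tubes; clock lag; far leaves in the radiation zone; flat closures; disjoint tubes). -/
def Sm (𝓢 : Spacetime.{0} 4) (O : Set 𝓢.carrier) (d : FinalStateDecomposition 𝓢 O 2)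
    (R : Fin d.N → ℝ → ℝ) (R₀ : ℝ) : Prop :=
  let B := d.background; let t := fun i ↦ (B i).time; let r := fun i ↦ (B i).radius;
  let Λ := fun i ↦ ((d.motion i).1 : E4 ≃L[ℝ] E4); let Φ := d.flatChart; let Ψ := d.chart; let ρ := d.excision;
  (∀ i, Monotone (R i) ∧ Continuous (R i) ∧ ∀ s, R₀ + 4 ≤ R i s ∧ R₀ ≤ ρ i s) ∧
  (∀ i, Tendsto (fun τ ↦ 𝓢.truncDeviationCk (B i) (Ψ i) 2 (R i τ) τ) atTop (𝓝 0)) ∧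
  supCkENorm (Subtype.val '' {y : d.flatDomain | d.τ₀ ≤ y.1 0}) 0
      (𝓢.deviationExtend (Minkowski.backgroundOn d.flatDomain) Φ) ≤ 10⁻¹ ∧
  (∀ i, supCkENorm (Subtype.val '' {x : (B i).domain | (d.τ₀ ≤ t i x.1 ∨ d.τ₀ ≤ x.1 0) ∧ R₀ ≤ r i x.1 ∧
      r i x.1 ≤ R i (t i x.1)}) 0 (𝓢.deviationExtend (B i) (Ψ i)) ≤
        ENNReal.ofReal (1 / (10 * ‖(Λ i : E4 →L[ℝ] E4)‖ ^ 2))) ∧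
  (∀ i (x : (B i).domain), (d.τ₀ ≤ t i x.1 ∨ d.τ₀ ≤ x.1 0) → R₀ ≤ r i x.1 → r i x.1 ≤ R i (t i x.1) →
      𝓢.timeOrientation.IsFutureDirected (mfderiv 𝓘(ℝ, E4) (𝓡 4) (Ψ i) x ((Λ i) (E4.basisVector 0)))) ∧
  (∀ i (y : E4) (hy : y ∈ (B i).domain), d.τ₀ ≤ y 0 → (∀ j, ρ j (y 0) < r j y) →
      r i y ≤ R i (t i y) + 1 → ∃ hy' : y ∈ d.flatDomain, Ψ i ⟨y, hy⟩ = Φ ⟨y, hy'⟩) ∧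
  (∀ y : d.flatDomain, d.τ₀ ≤ y.1 0 → ∀ j, ρ j (y.1 0) < r j y.1) ∧
  (∀ j (y : E4), d.τ₀ ≤ y 0 → r j y ≤ ρ j (y 0) → r j y + 2 ≤ R j (t j y)) ∧
  (∀ j (y : E4), d.τ₀ ≤ t j y → r j y ≤ R j (t j y) + 2 → t j y ≤ y 0) ∧
  (∀ j, Ψ j '' {x | d.τ₀ < t j x.1 ∧ R j (t j x.1) + 1 < r j x.1} ⊆ d.radiationZone) ∧
  (∀ τ' : ℝ, d.τ₀ < τ' → closure (Φ '' {y | τ' ≤ y.1 0}) ⊆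
      Φ '' {y | τ' ≤ y.1 0} ∪ ⋃ j, Ψ j '' {x | τ' ≤ x.1 0 ∧ r j x.1 = ρ j (x.1 0)}) ∧
  (∀ j j' (y : E4), j ≠ j' → (d.τ₀ ≤ y 0 ∨ d.τ₀ ≤ t j y) → r j y ≤ R j (t j y) + 1 →
      R j' (t j' y) + 1 < r j' y)

/-- READ-BACK (`Iff.rfl`): the crux restated through the named copies `Hc`, `Sm` is definitionally
the route decl `StarvedNecks.SeamedChartsExhaust`. -/
theorem crux_iff :
    _root_.Summit.FinalStateConjecture.FinalStateConjecture.Theses.StarvedNecks.SeamedChartsExhaust ↔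
    (∀ (X : Type) [TopologicalSpace X] [ChartedSpace E3 X] [IsManifold (𝓡 3) ∞ X]
      [ConnectedSpace X] (D : InitialDataSet (𝓡 3) X), D ∈ admissibleVacuumData X →
      ∀ 𝒟 : VacuumCauchyDevelopment D, 𝒟.IsMaximal →
      ∀ (O : Set 𝒟.carrier) (d : FinalStateDecomposition 𝒟.toSpacetime O 2)
        (R : Fin d.N → ℝ → ℝ) (R₀ : ℝ), O = exteriorOf 𝒟.toCauchyDevelopment d.charted →
        Hc 𝒟.toSpacetime O 2 d R₀ → Sm 𝒟.toSpacetime O d R R₀ → HasExhaustiveCharts d) :=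
  Iff.rfl

/-- `r₊(M, a) = M + √(M² − a²) ≤ 2M` for `0 ≤ M` (ingoing Kerr–Schild horizon radius). -/
theorem rPlus_le_two_mul {M : ℝ} (hM : 0 ≤ M) (a : ℝ) : Kerr.rPlus M a ≤ 2 * M := by
  unfold Kerr.rPlus
  have h1 : √(M ^ 2 - a ^ 2) ≤ √(M ^ 2) := Real.sqrt_le_sqrt (by nlinarith [sq_nonneg a])
  rw [Real.sqrt_sq hM] at h1
  linarith

/-- **The landing set of the COVER half: RIDE-ABLE certified tube points up to hole time `τ₁`**
— points `Ψⱼ x` with `(τ₀ ≤ t*ⱼ ∨ τ₀ ≤ x⁰)`, `R₀ ≤ rⱼ ≤ Rⱼ(t*ⱼ)`, `t*ⱼ ≤ τ₁` (the union that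
`stub_rim` spells out verbatim; `abbrev`, so the two spellings are interchangeable by `rfl`). -/
abbrev rideable {𝓢 : Spacetime.{0} 4} {O : Set 𝓢.carrier} (d : FinalStateDecomposition 𝓢 O 2)
    (R : Fin d.N → ℝ → ℝ) (R₀ τ₁ : ℝ) : Set 𝓢.carrier :=
  ⋃ j, d.chart j '' {x | (d.τ₀ ≤ (d.background j).time x.1 ∨ d.τ₀ ≤ x.1 0) ∧
    R₀ ≤ (d.background j).radius x.1 ∧
    (d.background j).radius x.1 ≤ R j ((d.background j).time x.1) ∧
    (d.background j).time x.1 ≤ τ₁}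

/-! ## §1 The two REGISTERED STUBS (`theorem stub_… := by sorry`; the only `sorry`s of the file)

Both are stated over tree declarations only, with exactly the clauses they consume as hypotheses. -/

/-- **STUB 1 — FIRST CONTACT** (hardest; size M–L; the ONLY consumer of HonestCore (d)).
For a flat-late `y` with `τ₀ < y⁰ ≤ τ₁` follow the lab ray `g σ = y + σ e₀`, `σ ∈ [0, τ₁ − y⁰]`.
The CONTACT SET `C = {σ ∈ [0, τ₁ − y⁰] | ∃ k, rₖ(g σ) ≤ Rₖ(tₖ(g σ))}` is closed (finitely many `k`;
`rₖ, tₖ` continuous on `E4`: `Kerr.continuous_radius`, `continuous_poincareInv`; `Rₖ` continuous: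
`hR`). As long as every `rₖ(g σ) > Rₖ(tₖ(g σ)) − 2` the ray point lies in the flat domain `U`
(`h8` read contrapositively gives `ρₖ((g σ)⁰) < rₖ(g σ)`, then the structure field
`d.setOf_lt_excision_subset_flatDomain`; note `(g σ)⁰ = y⁰ + σ > τ₀`). Hence:
`C = ∅` ⇒ `g '' [0, τ₁ − y⁰] ⊆ U`, and since `U` is open there is a parameter collar
`[−ε, τ₁ − y⁰ + ε]`; `dΦ(e₀)` is future-directed along the ray (`hd`), so the flow lemma
(`line_mem_causalFuture`, proved below) gives `Φ y ≤ Φ(g(τ₁ − y⁰)) ∈ Φ(flat slab {x⁰ = τ₁})` —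
LEFT disjunct. `C ≠ ∅` ⇒ `u := min C` (`IsClosed.csInf_mem`); no contact strictly before `u`, and at
`u` (if `u > 0`) every `rⱼ − Rⱼ∘tⱼ ≥ 0 > −2` by continuity, so `g '' [0, u] ⊆ U` again, and the flow
lemma gives `Φ y ≤ Φ c` for the contact point `c = g u ∈ U`, `τ₀ < c⁰ = y⁰ + u ≤ τ₁`,
`rₖ(c) ≤ Rₖ(tₖ c)` — RIGHT disjunct. Clauses: Hc (d) = `hd`, SEAMED (1) continuity = `hR`,
SEAMED (8) = `h8`. (Checked against the landed negative model: `stub_firstContact_false_without_hd`;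
`N = 0` instance: `firstContact_N0`.) O'Neill 1983, Ch. 14, p. 402. -/
theorem stub_firstContact (𝓢 : Spacetime.{0} 4) (O : Set 𝓢.carrier)
    (d : FinalStateDecomposition 𝓢 O 2) (R : Fin d.N → ℝ → ℝ)
    (hd : ∀ y : d.flatDomain, d.τ₀ < y.1 0 →
      𝓢.timeOrientation.IsFutureDirected (mfderiv 𝓘(ℝ, E4) (𝓡 4) d.flatChart y (E4.basisVector 0)))
    (hR : ∀ i, Continuous (R i))
    (h8 : ∀ j (y : E4), d.τ₀ ≤ y 0 → (d.background j).radius y ≤ d.excision j (y 0) →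
      (d.background j).radius y + 2 ≤ R j ((d.background j).time y))
    (τ₁ : ℝ) (y : d.flatDomain) (hy₀ : d.τ₀ < y.1 0) (hy₁ : y.1 0 ≤ τ₁) :
    d.flatChart y ∈ 𝓢.metric.causalPast 𝓢.timeOrientation
        (d.flatChart '' (Minkowski.backgroundOn d.flatDomain).timeSlab τ₁) ∨
      ∃ (c : d.flatDomain) (k : Fin d.N), d.τ₀ < c.1 0 ∧ c.1 0 ≤ τ₁ ∧
        (d.background k).radius c.1 ≤ R k ((d.background k).time c.1) ∧
        d.flatChart y ∈ 𝓢.metric.causalPast 𝓢.timeOrientation {d.flatChart c} := by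
  sorry

/-- **STUB 2 — RIM ENUMERATION** (the COVER half; size M; NO causal content — closure bookkeeping
over the chart images; stated VERBATIM as `Lines/rim-criterion.lean`'s `stub_rim` so one proof serves
both lines). Every point of `O` in the closure of the certified late region after `τ₁` but not in
it lies on the certified slab at `τ₁` or is a ride-able certified tube point of some hole `j` (hole
time `≤ τ₁`, `R₀ ≤ rⱼ ≤ Rⱼ(tⱼ)`, hole-late or flat-late). Enumeration: `closure F = closure F₀ ∪
⋃ⱼ closure Fⱼ` (finite union); `closure F₀ ⊆ closure Φ''{τ₁ ≤ y⁰} ⊆` [SEAMED (11) at `τ' := τ₁`]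
flat points with `y⁰ ≥ τ₁` (`> τ₁`: in `F`; `= τ₁`: flat slab) or flat-tube WALL points `Ψⱼ x`,
`x⁰ ≥ τ₁`, `rⱼ x = ρⱼ(x⁰) ≥ R₀` [SEAMED (1)], `rⱼ + 2 ≤ Rⱼ(tⱼ x)` [SEAMED (8)] (`tⱼ x > τ₁`: in
`Fⱼ`, excluded; else ride-able through the flat-late disjunct `τ₀ ≤ x⁰` — this covers the
hole-EARLY/flat-late wall of the item's why-might-fail); `closure Fⱼ ∩ O ⊆` [HonestCore (c) with
the continuous profile `ϱ := Rⱼ`, `τ' := τ₁`] `Ψⱼ''{τ₁ ≤ t, r ≤ Rⱼ(t)}` (`t > τ₁`: in `Fⱼ`,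
lateral wall `r = Rⱼ(t)` INCLUDED by the `≤` of `certifiedLate`; `t = τ₁`: hole disc). Clauses:
Hc (c) = `hcl`, SEAMED (1) = `h1`, (8) = `h8`, (11) = `h11`. (`N = 0` instance: `rim_N0`.)
O'Neill 1983, Ch. 14, p. 403; Minguzzi, arXiv:1709.06494, §2. -/
theorem stub_rim (𝓢 : Spacetime.{0} 4) (O : Set 𝓢.carrier) (d : FinalStateDecomposition 𝓢 O 2)
    (R : Fin d.N → ℝ → ℝ) (R₀ : ℝ)
    (hcl : ∀ i (τ' : ℝ) (ϱ : ℝ → ℝ), Continuous ϱ → d.τ₀ < τ' →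
      closure (d.chart i '' {x | τ' ≤ (d.background i).time x.1 ∧
        (d.background i).radius x.1 ≤ ϱ ((d.background i).time x.1)}) ∩ O ⊆
      d.chart i '' {x | τ' ≤ (d.background i).time x.1 ∧
        (d.background i).radius x.1 ≤ ϱ ((d.background i).time x.1)})
    (h1 : ∀ i, Continuous (R i) ∧ ∀ s, R₀ ≤ d.excision i s)
    (h8 : ∀ j (y : E4), d.τ₀ ≤ y 0 → (d.background j).radius y ≤ d.excision j (y 0) →
      (d.background j).radius y + 2 ≤ R j ((d.background j).time y))
    (h11 : ∀ τ' : ℝ, d.τ₀ < τ' → closure (d.flatChart '' {y | τ' ≤ y.1 0}) ⊆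
      d.flatChart '' {y | τ' ≤ y.1 0} ∪
        ⋃ j, d.chart j '' {x | τ' ≤ x.1 0 ∧ (d.background j).radius x.1 = d.excision j (x.1 0)})
    (τ₁ : ℝ) (hτ₁ : d.τ₀ < τ₁) :
    (closure (certifiedLate d R τ₁) ∩ O) \ certifiedLate d R τ₁ ⊆
      certifiedSlab d R τ₁ ∪ ⋃ j, d.chart j '' {x | (d.τ₀ ≤ (d.background j).time x.1 ∨ d.τ₀ ≤ x.1 0) ∧
        R₀ ≤ (d.background j).radius x.1 ∧
        (d.background j).radius x.1 ≤ R j ((d.background j).time x.1) ∧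
        (d.background j).time x.1 ≤ τ₁} := by
  sorry

namespace Registered

/-- Registered stub 1, as a `Prop` (LITERALLY the type of `stub_firstContact`; name check below). -/
abbrev stub_firstContact : Prop :=
  ∀ (𝓢 : Spacetime.{0} 4) (O : Set 𝓢.carrier) (d : FinalStateDecomposition 𝓢 O 2)
    (R : Fin d.N → ℝ → ℝ),
    (∀ y : d.flatDomain, d.τ₀ < y.1 0 →
      𝓢.timeOrientation.IsFutureDirected (mfderiv 𝓘(ℝ, E4) (𝓡 4) d.flatChart y (E4.basisVector 0))) →
    (∀ i, Continuous (R i)) →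
    (∀ j (y : E4), d.τ₀ ≤ y 0 → (d.background j).radius y ≤ d.excision j (y 0) →
      (d.background j).radius y + 2 ≤ R j ((d.background j).time y)) →
    ∀ (τ₁ : ℝ) (y : d.flatDomain), d.τ₀ < y.1 0 → y.1 0 ≤ τ₁ →
      d.flatChart y ∈ 𝓢.metric.causalPast 𝓢.timeOrientation
          (d.flatChart '' (Minkowski.backgroundOn d.flatDomain).timeSlab τ₁) ∨
        ∃ (c : d.flatDomain) (k : Fin d.N), d.τ₀ < c.1 0 ∧ c.1 0 ≤ τ₁ ∧
          (d.background k).radius c.1 ≤ R k ((d.background k).time c.1) ∧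
          d.flatChart y ∈ 𝓢.metric.causalPast 𝓢.timeOrientation {d.flatChart c}

/-- Registered stub 2, as a `Prop` (LITERALLY the type of `stub_rim`; name check below). -/
abbrev stub_rim : Prop :=
  ∀ (𝓢 : Spacetime.{0} 4) (O : Set 𝓢.carrier) (d : FinalStateDecomposition 𝓢 O 2)
    (R : Fin d.N → ℝ → ℝ) (R₀ : ℝ),
    (∀ i (τ' : ℝ) (ϱ : ℝ → ℝ), Continuous ϱ → d.τ₀ < τ' →
      closure (d.chart i '' {x | τ' ≤ (d.background i).time x.1 ∧
        (d.background i).radius x.1 ≤ ϱ ((d.background i).time x.1)}) ∩ O ⊆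
      d.chart i '' {x | τ' ≤ (d.background i).time x.1 ∧
        (d.background i).radius x.1 ≤ ϱ ((d.background i).time x.1)}) →
    (∀ i, Continuous (R i) ∧ ∀ s, R₀ ≤ d.excision i s) →
    (∀ j (y : E4), d.τ₀ ≤ y 0 → (d.background j).radius y ≤ d.excision j (y 0) →
      (d.background j).radius y + 2 ≤ R j ((d.background j).time y)) →
    (∀ τ' : ℝ, d.τ₀ < τ' → closure (d.flatChart '' {y | τ' ≤ y.1 0}) ⊆
      d.flatChart '' {y | τ' ≤ y.1 0} ∪
        ⋃ j, d.chart j '' {x | τ' ≤ x.1 0 ∧ (d.background j).radius x.1 = d.excision j (x.1 0)}) →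
    ∀ (τ₁ : ℝ), d.τ₀ < τ₁ →
      (closure (certifiedLate d R τ₁) ∩ O) \ certifiedLate d R τ₁ ⊆
        certifiedSlab d R τ₁ ∪ ⋃ j, d.chart j '' {x | (d.τ₀ ≤ (d.background j).time x.1 ∨ d.τ₀ ≤ x.1 0) ∧
          R₀ ≤ (d.background j).radius x.1 ∧
          (d.background j).radius x.1 ≤ R j ((d.background j).time x.1) ∧
          (d.background j).time x.1 ≤ τ₁}

end Registered

/-- Name check: the registered stub `stub_firstContact` IS `Registered.stub_firstContact`. -/
theorem registered_firstContact : Registered.stub_firstContact := stub_firstContact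

/-- Name check: the registered stub `stub_rim` IS `Registered.stub_rim`. -/
theorem registered_rim : Registered.stub_rim := stub_rim

/-! ## §2 Kinematics of the co-moving ride `u ↦ x + u • Λⱼe₀` and the coordinate-line adapter -/

section Kinematics

/-- `spatial(e₀) = 0`: the time axis has no spatial part. -/
theorem spatial_e₀ : E4.spatial (E4.basisVector 0) = 0 := by
  ext i
  simp [Fin.succ_ne_zero]

/-- Translating along the time axis does not change the Kerr–Schild radius (`r` is spatial). -/
theorem radius_add_smul_e₀ (a u : ℝ) (p : E4) :
    Kerr.radius a (p + u • E4.basisVector 0) = Kerr.radius a p := by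
  have h3 : (p + u • E4.basisVector 0) 3 = p 3 := by
    simp [E4.basisVector]
  have hn : E4.spatialNorm (p + u • E4.basisVector 0) = E4.spatialNorm p := by
    simp [E4.spatialNorm, map_add, map_smul, spatial_e₀]
  simp only [Kerr.radius, hn, h3]

/-- The inverse Poincaré map is affine: a step `u • Λe₀` in the lab is a step `u • e₀` in the rest
frame, `Λ⁻¹(x + uΛe₀ − c) = Λ⁻¹(x − c) + u e₀`. -/
theorem poincareInv_add_smul (Λ : lorentzGroup) (c p : E4) (u : ℝ) :
    poincareInv Λ c (p + u • (Λ : E4 ≃L[ℝ] E4) (E4.basisVector 0)) =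
      poincareInv Λ c p + u • E4.basisVector 0 := by
  simp only [poincareInv]
  have : p + u • (Λ : E4 ≃L[ℝ] E4) (E4.basisVector 0) - c =
      (p - c) + u • (Λ : E4 ≃L[ℝ] E4) (E4.basisVector 0) := by abel
  rw [this, map_add, map_smul, ContinuousLinearEquiv.symm_apply_apply]

variable {𝓢 : Spacetime.{0} 4} {O : Set 𝓢.carrier} {k : ℕ} (d : FinalStateDecomposition 𝓢 O k)
  (j : Fin d.N)

/-- Along the ride the hole clock rises at unit rate: `t*ⱼ(x + uΛⱼe₀) = t*ⱼ(x) + u`. -/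
theorem time_ride (p : E4) (u : ℝ) :
    (d.background j).time (p + u • ((d.motion j).1 : E4 ≃L[ℝ] E4) (E4.basisVector 0)) =
      (d.background j).time p + u := by
  show poincareInv (d.motion j).1 (d.motion j).2
      (p + u • ((d.motion j).1 : E4 ≃L[ℝ] E4) (E4.basisVector 0)) 0 =
    poincareInv (d.motion j).1 (d.motion j).2 p 0 + u
  rw [poincareInv_add_smul]
  simp

/-- Along the ride the rest-frame Kerr–Schild radius is constant. -/
theorem radius_ride (p : E4) (u : ℝ) :
    (d.background j).radius (p + u • ((d.motion j).1 : E4 ≃L[ℝ] E4) (E4.basisVector 0)) =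
      (d.background j).radius p := by
  show Kerr.radius (d.spin j) (poincareInv (d.motion j).1 (d.motion j).2
      (p + u • ((d.motion j).1 : E4 ≃L[ℝ] E4) (E4.basisVector 0))) =
    Kerr.radius (d.spin j) (poincareInv (d.motion j).1 (d.motion j).2 p)
  rw [poincareInv_add_smul, radius_add_smul_e₀]

/-- Along the ride the lab clock moves at rate `(Λⱼe₀)⁰` (positive for an orthochronous `Λⱼ`). -/
theorem coord0_ride (p : E4) (u : ℝ) :
    (p + u • ((d.motion j).1 : E4 ≃L[ℝ] E4) (E4.basisVector 0)) 0 =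
      p 0 + u * ((d.motion j).1 : E4 ≃L[ℝ] E4) (E4.basisVector 0) 0 := by
  simp

/-- The ride never leaves hole `j`'s chart domain (the boosted Kerr exterior is `{rⱼ > max(r₊, 0)}`
and `rⱼ` is constant along it). -/
theorem mem_domain_ride {p : E4} (hp : p ∈ (d.background j).domain) (u : ℝ) :
    p + u • ((d.motion j).1 : E4 ≃L[ℝ] E4) (E4.basisVector 0) ∈ (d.background j).domain := by
  have hp' : poincareInv (d.motion j).1 (d.motion j).2 p ∈ Kerr.exterior (d.mass j) (d.spin j) := hp
  show poincareInv (d.motion j).1 (d.motion j).2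
      (p + u • ((d.motion j).1 : E4 ≃L[ℝ] E4) (E4.basisVector 0)) ∈ Kerr.exterior (d.mass j) (d.spin j)
  rw [poincareInv_add_smul, Kerr.mem_exterior, radius_add_smul_e₀]
  exact Kerr.mem_exterior.mp hp'

/-- Lab time along the lab ray: `(p + u e₀)⁰ = p⁰ + u`. -/
theorem coord0_add_smul_e₀ (p : E4) (u : ℝ) : (p + u • E4.basisVector 0) 0 = p 0 + u := by
  simp

end Kinematics

section Flow

variable {𝓢 : Spacetime.{0} 4}

/-- **Coordinate lines through a chart are causal curves** (the adapter; reproduced VERBATIM from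
the landed `Theorems/SeamedChartsExhaust/Negative/NoHoleCase.lean`, `Negative.line_mem_causalFuture`
(refuter-cdisprove-stmt-FinalStateConjecture-13551-0, p74470) — to be replaced by an `import` of
that module once the farm has built it). Let `Φ : U → 𝓢` be smooth on an open `U ⊆ E4`, `v ∈ E4`,
and suppose the segment `σ ↦ y + σ v`, `σ ∈ [−ε, s + ε]`, lies in `U` and `dΦ(v)` is future-directed
causal along `σ ∈ [0, s]`. Then `Φ(y) ≤ Φ(y + s v)`. (The parameter is clamped to `[−ε, s + ε]` to
get a globally defined curve differentiable on the CLOSED interval `[0, s]`, as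
`IsFutureCausalCurveOn` demands.) O'Neill 1983, Ch. 14, p. 402. -/
theorem line_mem_causalFuture {U : Opens E4} {Φ : U → 𝓢.carrier}
    (hΦ : ContMDiff 𝓘(ℝ, E4) (𝓡 4) ∞ Φ) (v y : E4) (hy : y ∈ U) {s ε : ℝ} (hs : 0 ≤ s) (hε : 0 < ε)
    (hmem : ∀ σ ∈ Icc (-ε) (s + ε), y + σ • v ∈ U)
    (hfut : ∀ z : U, z.1 ∈ (fun σ : ℝ ↦ y + σ • v) '' Icc 0 s →
      𝓢.timeOrientation.IsFutureDirected (mfderiv 𝓘(ℝ, E4) (𝓡 4) Φ z v)) :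
    Φ ⟨y + s • v, hmem s ⟨by linarith, by linarith⟩⟩ ∈
      𝓢.metric.causalFuture 𝓢.timeOrientation {Φ ⟨y, hy⟩} := by
  rcases hs.eq_or_lt with hs0 | hs'
  · subst hs0
    have : (⟨y + (0 : ℝ) • v, hmem 0 ⟨by linarith, by linarith⟩⟩ : U) = ⟨y, hy⟩ := Subtype.ext (by simp)
    rw [this]
    exact Or.inl rfl
  -- clamp the parameter
  set c : ℝ → ℝ := fun σ ↦ max (-ε) (min σ (s + ε)) with hc
  have hcmem : ∀ σ, c σ ∈ Icc (-ε) (s + ε) := fun σ ↦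
    ⟨le_max_left _ _, max_le (by linarith) (min_le_right _ _)⟩
  have hcid : ∀ σ ∈ Ioo (-ε) (s + ε), c σ = σ := fun σ hσ ↦ by
    simp only [hc]
    rw [min_eq_left hσ.2.le, max_eq_right hσ.1.le]
  set ι : ℝ → U := fun σ ↦ ⟨y + c σ • v, hmem (c σ) (hcmem σ)⟩ with hι
  have hιval : ∀ σ, (ι σ).1 = y + c σ • v := fun σ ↦ rfl
  set γ : ℝ → 𝓢.carrier := fun σ ↦ Φ (ι σ) with hγ
  have hι0 : ι 0 = ⟨y, hy⟩ := Subtype.ext (by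
    rw [hιval, hcid 0 ⟨by linarith, by linarith⟩]; simp)
  have hιs : ι s = ⟨y + s • v, hmem s ⟨by linarith, by linarith⟩⟩ := Subtype.ext (by
    rw [hιval, hcid s ⟨by linarith, by linarith⟩])
  refine Or.inr ⟨Φ ⟨y, hy⟩, rfl, γ, 0, s, hs', ?_, ?_, ?_⟩
  · intro t ht
    have htI : t ∈ Ioo (-ε) (s + ε) := ⟨by linarith [ht.1], by linarith [ht.2]⟩
    have hev : ∀ᶠ σ in 𝓝 t, c σ = σ :=
      Filter.eventually_of_mem (isOpen_Ioo.mem_nhds htI) fun σ hσ ↦ hcid σ hσ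
    have hval : (Subtype.val ∘ ι) =ᶠ[𝓝 t] fun σ : ℝ ↦ y + σ • v :=
      hev.mono fun σ hσ ↦ by simp only [Function.comp_apply, hιval, hσ]
    have haff : ContMDiff 𝓘(ℝ, ℝ) 𝓘(ℝ, E4) ∞ (fun σ : ℝ ↦ y + σ • v) :=
      (contDiff_const.add (contDiff_id.smul contDiff_const)).contMDiff
    have hιs' : ContMDiffAt 𝓘(ℝ, ℝ) 𝓘(ℝ, E4) ∞ ι t := by
      rw [← ContMDiffAt.subtypeVal_comp_iff]
      exact haff.contMDiffAt.congr_of_eventuallyEq hval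
    have hιd : MDifferentiableAt 𝓘(ℝ, ℝ) 𝓘(ℝ, E4) ι t := hιs'.mdifferentiableAt (by simp)
    have hΦd : MDifferentiableAt 𝓘(ℝ, E4) (𝓡 4) Φ (ι t) := hΦ.mdifferentiableAt (by simp)
    have hγd : MDifferentiableAt 𝓘(ℝ, ℝ) (𝓡 4) γ t := hΦd.comp t hιd
    -- the velocity of `ι` is `v`
    have hder : HasDerivAt (fun σ : ℝ ↦ y + σ • v) v t := by
      simpa using ((hasDerivAt_id t).smul_const v).const_add y
    have h3 : mfderiv 𝓘(ℝ, ℝ) 𝓘(ℝ, E4) (fun σ : ℝ ↦ y + σ • v) t (1 : ℝ) = v := by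
      rw [mfderiv_eq_fderiv]
      change fderiv ℝ (fun σ : ℝ ↦ y + σ • v) t 1 = v
      rw [hder.hasFDerivAt.fderiv]
      simp
    have hvι : mfderiv 𝓘(ℝ, ℝ) 𝓘(ℝ, E4) ι t (1 : ℝ) = v := by
      have h1 : mfderiv 𝓘(ℝ, ℝ) 𝓘(ℝ, E4) (Subtype.val ∘ ι) t =
          (mfderiv 𝓘(ℝ, E4) 𝓘(ℝ, E4) (Subtype.val : U → E4) (ι t)).comp
            (mfderiv 𝓘(ℝ, ℝ) 𝓘(ℝ, E4) ι t) :=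
        mfderiv_comp t
          ((contMDiff_subtype_val : ContMDiff 𝓘(ℝ, E4) 𝓘(ℝ, E4) ∞ (Subtype.val : U → E4)).mdifferentiableAt
            (by simp)) hιd
      have h2 : mfderiv 𝓘(ℝ, ℝ) 𝓘(ℝ, E4) (Subtype.val ∘ ι) t =
          mfderiv 𝓘(ℝ, ℝ) 𝓘(ℝ, E4) (fun σ : ℝ ↦ y + σ • v) t := hval.mfderiv_eq
      have h4 : (mfderiv 𝓘(ℝ, E4) 𝓘(ℝ, E4) (Subtype.val : U → E4) (ι t))
          ((mfderiv 𝓘(ℝ, ℝ) 𝓘(ℝ, E4) ι t) (1 : ℝ)) =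
          (mfderiv 𝓘(ℝ, ℝ) 𝓘(ℝ, E4) (fun σ : ℝ ↦ y + σ • v) t) (1 : ℝ) := by
        have := congrArg (fun L ↦ L (1 : ℝ)) h1
        rw [h2] at this
        exact this.symm
      rw [h3, OpensChart.mfderiv_subtypeVal_apply] at h4
      exact h4
    have hvel : velocity (𝓡 4) γ t = mfderiv 𝓘(ℝ, E4) (𝓡 4) Φ (ι t) v := by
      unfold velocity
      rw [show γ = Φ ∘ ι from rfl, mfderiv_comp t hΦd hιd]
      show (mfderiv 𝓘(ℝ, E4) (𝓡 4) Φ (ι t)) ((mfderiv 𝓘(ℝ, ℝ) 𝓘(ℝ, E4) ι t) (1 : ℝ)) = _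
      rw [hvι]
    refine ⟨hγd, ?_⟩
    rw [hvel]
    refine hfut (ι t) ⟨c t, ?_, (hιval t).symm⟩
    rw [hcid t htI]
    exact ht
  · show Φ (ι 0) = Φ ⟨y, hy⟩
    rw [hι0]
  · show Φ (ι s) = Φ ⟨y + s • v, hmem s ⟨by linarith, by linarith⟩⟩
    rw [hιs]

/-- `J⁻` is transitive over sets: `x ≤ y` and `y ∈ J⁻(S)` give `x ∈ J⁻(S)`
(`causalFuture_causalFuture_eq` for the reversed time orientation). -/
theorem causalPast_trans {S : Set 𝓢.carrier} {x y : 𝓢.carrier}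
    (hxy : x ∈ 𝓢.metric.causalPast 𝓢.timeOrientation {y})
    (hyS : y ∈ 𝓢.metric.causalPast 𝓢.timeOrientation S) :
    x ∈ 𝓢.metric.causalPast 𝓢.timeOrientation S := by
  have hn2 : (2 : WithTop ℕ∞) ≤ ((⊤ : ℕ∞) : WithTop ℕ∞) := WithTop.coe_le_coe.mpr le_top
  have h : x ∈ 𝓢.metric.causalFuture 𝓢.timeOrientation.reverse
      (𝓢.metric.causalFuture 𝓢.timeOrientation.reverse S) :=
    LorentzianMetric.causalFuture_mono (Set.singleton_subset_iff.mpr hyS) hxy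
  rw [LorentzianMetric.causalFuture_causalFuture_eq hn2] at h
  exact h

end Flow

/-! ## §3 Proved glue -/

/-! ### RIDE, proved (this is `Lines/rim-criterion.lean`'s `stub_tubeRide`, verbatim statement) -/

/-- **The co-moving ride drains the ride-able set** (PROVED; verbatim the statement of
rim-criterion's `stub_tubeRide`): a ride-able certified tube point `Ψⱼ x` lies in `J⁻` of the
certified slab at `τ₁` — the segment `u ↦ Ψⱼ(x + uΛⱼe₀)`, `u ∈ [0, τ₁ − t*ⱼ x]`, has constant
rest-frame radius (`radius_ride`), hole clock `+u` (`time_ride`), lab clock `+u(Λⱼe₀)⁰ ≥ 0`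
(`horth`, orthochronous HonestCore (a)), so the window of SEAMED (5) persists along it (`hmono`,
SEAMED (1)) and it is a future causal curve (`line_mem_causalFuture`) ending on
`truncTimeSlab (Rⱼ τ₁) τ₁ ⊆ certifiedSlab`. Clauses: Hc (a)-orthochronous, Sm (1)-monotone, Sm (5). -/
theorem tubeRide (𝓢 : Spacetime.{0} 4) (O : Set 𝓢.carrier) (d : FinalStateDecomposition 𝓢 O 2)
    (R : Fin d.N → ℝ → ℝ) (R₀ : ℝ)
    (horth : ∀ i, 0 < ((d.motion i).1 : E4 ≃L[ℝ] E4) (E4.basisVector 0) 0)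
    (hmono : ∀ i, Monotone (R i))
    (h5 : ∀ i (x : (d.background i).domain),
      (d.τ₀ ≤ (d.background i).time x.1 ∨ d.τ₀ ≤ x.1 0) → R₀ ≤ (d.background i).radius x.1 →
      (d.background i).radius x.1 ≤ R i ((d.background i).time x.1) →
      𝓢.timeOrientation.IsFutureDirected
        (mfderiv 𝓘(ℝ, E4) (𝓡 4) (d.chart i) x (((d.motion i).1 : E4 ≃L[ℝ] E4) (E4.basisVector 0))))
    (τ₁ : ℝ) :
    (⋃ j, d.chart j '' {x | (d.τ₀ ≤ (d.background j).time x.1 ∨ d.τ₀ ≤ x.1 0) ∧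
        R₀ ≤ (d.background j).radius x.1 ∧
        (d.background j).radius x.1 ≤ R j ((d.background j).time x.1) ∧
        (d.background j).time x.1 ≤ τ₁}) ⊆
      𝓢.metric.causalPast 𝓢.timeOrientation (certifiedSlab d R τ₁) := by
  intro z hz
  obtain ⟨j, hz⟩ := mem_iUnion.mp hz
  obtain ⟨x, ⟨hlate, hr₀, hrR, ht⟩, rfl⟩ := hz
  have hmem : ∀ σ : ℝ, x.1 + σ • ((d.motion j).1 : E4 ≃L[ℝ] E4) (E4.basisVector 0) ∈
      (d.background j).domain := fun σ ↦ mem_domain_ride d j x.2 σ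
  have hs0 : 0 ≤ τ₁ - (d.background j).time x.1 := by linarith
  have key := line_mem_causalFuture (d.isLateChart j).contMDiff
    (((d.motion j).1 : E4 ≃L[ℝ] E4) (E4.basisVector 0)) x.1 x.2 hs0 one_pos (fun σ _ ↦ hmem σ) ?_
  · -- the endpoint lies on the hole disc of the certified slab
    have hzT : (⟨x.1 + (τ₁ - (d.background j).time x.1) •
        ((d.motion j).1 : E4 ≃L[ℝ] E4) (E4.basisVector 0), hmem _⟩ : (d.background j).domain) ∈
        (d.background j).truncTimeSlab (R j τ₁) τ₁ := by
      constructor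
      · show (d.background j).time (x.1 + (τ₁ - (d.background j).time x.1) •
            ((d.motion j).1 : E4 ≃L[ℝ] E4) (E4.basisVector 0)) = τ₁
        rw [time_ride]
        ring
      · show (d.background j).radius (x.1 + (τ₁ - (d.background j).time x.1) •
            ((d.motion j).1 : E4 ≃L[ℝ] E4) (E4.basisVector 0)) ≤ R j τ₁
        rw [radius_ride]
        exact hrR.trans (hmono j ht)
    have hzS : d.chart j ⟨x.1 + (τ₁ - (d.background j).time x.1) •
        ((d.motion j).1 : E4 ≃L[ℝ] E4) (E4.basisVector 0), hmem _⟩ ∈ certifiedSlab d R τ₁ :=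
      Or.inr (mem_iUnion.mpr ⟨j, _, hzT, rfl⟩)
    exact LorentzianMetric.causalFuture_mono (singleton_subset_iff.mpr hzS)
      (LorentzianMetric.mem_causalPast_of_mem_causalFuture key)
  · -- future-directedness of `dΨⱼ(Λⱼe₀)` along the segment: SEAMED (5)
    rintro ⟨z, hz⟩ ⟨σ, hσ, hzσ⟩
    have hzσ' : z = x.1 + σ • ((d.motion j).1 : E4 ≃L[ℝ] E4) (E4.basisVector 0) := hzσ.symm
    subst hzσ'
    have hσ0 : 0 ≤ σ := hσ.1
    refine h5 j ⟨_, hz⟩ ?_ ?_ ?_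
    · rcases hlate with h | h
      · left
        show d.τ₀ ≤ (d.background j).time (x.1 + σ • ((d.motion j).1 : E4 ≃L[ℝ] E4) (E4.basisVector 0))
        rw [time_ride]
        linarith
      · right
        show d.τ₀ ≤ (x.1 + σ • ((d.motion j).1 : E4 ≃L[ℝ] E4) (E4.basisVector 0)) 0
        rw [coord0_ride]
        have hprod : 0 ≤ σ * ((d.motion j).1 : E4 ≃L[ℝ] E4) (E4.basisVector 0) 0 :=
          mul_nonneg hσ0 (horth j).le
        linarith
    · show R₀ ≤ (d.background j).radius (x.1 + σ • ((d.motion j).1 : E4 ≃L[ℝ] E4) (E4.basisVector 0))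
      rw [radius_ride]
      exact hr₀
    · show (d.background j).radius (x.1 + σ • ((d.motion j).1 : E4 ≃L[ℝ] E4) (E4.basisVector 0)) ≤
        R j ((d.background j).time (x.1 + σ • ((d.motion j).1 : E4 ≃L[ℝ] E4) (E4.basisVector 0)))
      rw [radius_ride, time_ride]
      exact hrR.trans (hmono j (by linarith))

/-- The ride from the bundles: `rideable d R R₀ τ₁ ⊆ J⁻(certifiedSlab d R τ₁)` under `Hc ∧ Sm`. -/
theorem rideable_subset_causalPast {𝓢 : Spacetime.{0} 4} {O : Set 𝓢.carrier}
    {d : FinalStateDecomposition 𝓢 O 2} {R : Fin d.N → ℝ → ℝ} {R₀ : ℝ}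
    (hc : Hc 𝓢 O 2 d R₀) (hs : Sm 𝓢 O d R R₀) (τ₁ : ℝ) :
    rideable d R R₀ τ₁ ⊆ 𝓢.metric.causalPast 𝓢.timeOrientation (certifiedSlab d R τ₁) :=
  tubeRide 𝓢 O d R R₀ (fun i ↦ (hc.1 i).2.2) (fun i ↦ (hs.1 i).1) hs.2.2.2.2.1 τ₁

/-! ### BOARDING at the contact point, proved (chart switch by ONE ATLAS; no causal content) -/

/-- **A contact point is a ride-able certified tube point** (PROVED; chart bookkeeping only): a
flat-late `c ∈ U`, `τ₀ < c⁰ ≤ τ₁`, inside a closed certified tube `rₖ(c) ≤ Rₖ(tₖ c)` satisfies: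
SEAMED (7) puts `c` outside every flat tube, so `rₖ(c) > ρₖ(c⁰) ≥ R₀ ≥ 100 Mₖ > r₊` (SEAMED (1),
HonestCore (a)) and `c ∈ domₖ`; ONE ATLAS (6) gives `Φ c = Ψₖ c`; clock lag (9) (or hole-earliness)
gives `tₖ(c) ≤ τ₁`. Clauses: Hc (a) `100M ≤ R₀`, Sm (1) `R₀ ≤ ρ`, Sm (6), (7), (9). -/
theorem contact_mem_rideable {𝓢 : Spacetime.{0} 4} {O : Set 𝓢.carrier}
    (d : FinalStateDecomposition 𝓢 O 2) (R : Fin d.N → ℝ → ℝ) (R₀ : ℝ)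
    (ha : ∀ i, 100 * d.mass i ≤ R₀)
    (h1 : ∀ i s, R₀ ≤ d.excision i s)
    (h6 : ∀ i (y : E4) (hy : y ∈ (d.background i).domain), d.τ₀ ≤ y 0 →
      (∀ j, d.excision j (y 0) < (d.background j).radius y) →
      (d.background i).radius y ≤ R i ((d.background i).time y) + 1 →
      ∃ hy' : y ∈ d.flatDomain, d.chart i ⟨y, hy⟩ = d.flatChart ⟨y, hy'⟩)
    (h7 : ∀ y : d.flatDomain, d.τ₀ ≤ y.1 0 → ∀ j, d.excision j (y.1 0) < (d.background j).radius y.1)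
    (h9 : ∀ j (y : E4), d.τ₀ ≤ (d.background j).time y →
      (d.background j).radius y ≤ R j ((d.background j).time y) + 2 → (d.background j).time y ≤ y 0)
    (τ₁ : ℝ) (c : d.flatDomain) (k : Fin d.N) (hc₀ : d.τ₀ < c.1 0) (hc₁ : c.1 0 ≤ τ₁)
    (hrR : (d.background k).radius c.1 ≤ R k ((d.background k).time c.1)) :
    d.flatChart c ∈ rideable d R R₀ τ₁ := by
  have hout : ∀ j, d.excision j (c.1 0) < (d.background j).radius c.1 := h7 c hc₀.le
  have hR₀r : R₀ < (d.background k).radius c.1 := lt_of_le_of_lt (h1 k (c.1 0)) (hout k)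
  -- `c` lies in the chart domain of hole `k`
  have hM := d.mass_pos k
  have hdom : c.1 ∈ (d.background k).domain := by
    show poincareInv (d.motion k).1 (d.motion k).2 c.1 ∈ Kerr.exterior (d.mass k) (d.spin k)
    rw [Kerr.mem_exterior]
    have h2M := rPlus_le_two_mul hM.le (d.spin k)
    have h100 := ha k
    refine max_lt ?_ ?_
    · show Kerr.rPlus (d.mass k) (d.spin k) < (d.background k).radius c.1
      linarith
    · show (0 : ℝ) < (d.background k).radius c.1
      linarith
  -- one atlas
  obtain ⟨hc', hEq⟩ := h6 k c.1 hdom hc₀.le hout (by linarith)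
  -- hole clock at most `τ₁`
  have htk : (d.background k).time c.1 ≤ τ₁ := by
    by_cases h : d.τ₀ ≤ (d.background k).time c.1
    · exact (h9 k c.1 h (by linarith)).trans hc₁
    · push Not at h
      linarith
  refine mem_iUnion.mpr ⟨k, ⟨c.1, hdom⟩, ⟨Or.inr hc₀.le, hR₀r.le, hrR, htk⟩, ?_⟩
  -- `⟨c.1, hc'⟩ = c` by structure eta
  rw [hEq]

/-! ### The line's internal statements (bundle form, as in generation 1 and the sibling lines) -/

/-- **BOARD**: a flat-late point with flat time in `(τ₀, τ₁]` lies in `J⁻` of the certified slab at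
`τ₁` (= generation 1's `stub_flatBoarding`, = `Sketch3.FlatBoarding`; DERIVED here from STUB 1). -/
def FlatBoarding : Prop :=
  ∀ (𝓢 : Spacetime.{0} 4) (O : Set 𝓢.carrier) (d : FinalStateDecomposition 𝓢 O 2)
    (R : Fin d.N → ℝ → ℝ) (R₀ : ℝ), Hc 𝓢 O 2 d R₀ → Sm 𝓢 O d R R₀ →
    ∀ τ₁ : ℝ, d.τ₀ < τ₁ → ∀ y : d.flatDomain, d.τ₀ < y.1 0 → y.1 0 ≤ τ₁ →
      d.flatChart y ∈ 𝓢.metric.causalPast 𝓢.timeOrientation (certifiedSlab d R τ₁)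

/-- **REACH**: every charted point outside the certified late region lies in the causal past of the
certified slab (= `Sketch3.ChartedReach` = `Ideate1.DrainCharted`; DERIVED from BOARD). -/
def ChartedReach : Prop :=
  ∀ (𝓢 : Spacetime.{0} 4) (O : Set 𝓢.carrier) (d : FinalStateDecomposition 𝓢 O 2)
    (R : Fin d.N → ℝ → ℝ) (R₀ : ℝ), Hc 𝓢 O 2 d R₀ → Sm 𝓢 O d R R₀ →
    ∀ τ₁ : ℝ, d.τ₀ < τ₁ →
      d.charted \ certifiedLate d R τ₁ ⊆
        𝓢.metric.causalPast 𝓢.timeOrientation (certifiedSlab d R τ₁)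

/-- **FRONTIER**: the frontier of the (open) certified late region inside `O` lies in the causal
past of the certified slab (= generation 1's `stub_frontierBelowSlab` = abstract-exterior's
`stub_frontier` = `Sketch3.FrontierBelowSlab`; DERIVED here from STUB 2 and the ride). -/
def FrontierBelowSlab : Prop :=
  ∀ (𝓢 : Spacetime.{0} 4) (O : Set 𝓢.carrier) (d : FinalStateDecomposition 𝓢 O 2)
    (R : Fin d.N → ℝ → ℝ) (R₀ : ℝ), Hc 𝓢 O 2 d R₀ → Sm 𝓢 O d R R₀ →
    ∀ τ₁ : ℝ, d.τ₀ < τ₁ →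
      (closure (certifiedLate d R τ₁) ∩ O) \ certifiedLate d R τ₁ ⊆
        𝓢.metric.causalPast 𝓢.timeOrientation (certifiedSlab d R τ₁)

/-- **OPEN**: under SEAMED the certified late region is open (PROVED, `certifiedLateIsOpen_holds`). -/
def CertifiedLateIsOpen : Prop :=
  ∀ (𝓢 : Spacetime.{0} 4) (O : Set 𝓢.carrier) (d : FinalStateDecomposition 𝓢 O 2)
    (R : Fin d.N → ℝ → ℝ) (R₀ : ℝ), Sm 𝓢 O d R R₀ →
    ∀ τ₁ : ℝ, d.τ₀ < τ₁ → IsOpen (certifiedLate d R τ₁)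

/-! ### BOARD from STUB 1, FRONTIER from STUB 2 (proved) -/

/-- **`stub_firstContact → FlatBoarding`** (PROVED): no contact ⇒ the flat slab is part of the
certified slab; contact at `c` ⇒ `Φ y ≤ Φ c ∈ rideable ⊆ J⁻(certified slab)`
(`contact_mem_rideable`, `tubeRide`) and `J⁻ ∘ J⁻ = J⁻`. -/
theorem flatBoarding_of_firstContact (h : Registered.stub_firstContact) : FlatBoarding := by
  intro 𝓢 O d R R₀ hc hs τ₁ hτ₁ y hy₀ hy₁
  have hride := rideable_subset_causalPast hc hs τ₁
  obtain ⟨ha, -, -, hd⟩ := hc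
  obtain ⟨h1, -, -, -, -, h6, h7, h8, h9, -, -, -⟩ := hs
  rcases h 𝓢 O d R (fun y hy ↦ hd y hy) (fun i ↦ (h1 i).2.1) h8 τ₁ y hy₀ hy₁ with
    hslab | ⟨c, k, hc₀, hc₁, hrR, hyc⟩
  · refine LorentzianMetric.causalFuture_mono ?_ hslab
    intro z hz
    exact Or.inl hz
  · have hcT : d.flatChart c ∈ rideable d R R₀ τ₁ :=
      contact_mem_rideable d R R₀ (fun i ↦ (ha i).2.1) (fun i s ↦ ((h1 i).2.2 s).2) h6 h7 h9
        τ₁ c k hc₀ hc₁ hrR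
    exact causalPast_trans hyc (hride hcT)

/-- **`stub_rim → FrontierBelowSlab`** (PROVED): the rim lands on `certifiedSlab ∪ rideable`, the
slab is in its own causal past and the ride drains the ride-able set (`tubeRide`). -/
theorem frontierBelowSlab_of_rim (h : Registered.stub_rim) : FrontierBelowSlab := by
  intro 𝓢 O d R R₀ hc hs τ₁ hτ₁ z hz
  have hride := rideable_subset_causalPast hc hs τ₁
  obtain ⟨-, -, hcc, -⟩ := hc
  obtain ⟨h1, -, -, -, -, -, -, h8, -, -, h11, -⟩ := hs
  have hrim := h 𝓢 O d R R₀ hcc (fun i ↦ ⟨(h1 i).2.1, fun s ↦ ((h1 i).2.2 s).2⟩) h8 h11 τ₁ hτ₁ hz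
  rcases hrim with hS | hT
  · exact LorentzianMetric.subset_causalPast _ _ _ hS
  · exact hride hT

/-! ### Wide anchoring and the hole-side routing, proved (the lever of the line) -/

/-- **Wide anchoring** (the card's first lemma): `Hc` (b) at the `τ₁`-dependent radius
`ϱ := Rᵢ(τ₁)` (admissible by SEAMED (1): `R₀ + 4 ≤ Rᵢ`) and `τ₂ := τ₁` puts the whole sub-slab part
of hole `i`'s tube into `J⁻(certifiedSlab d R τ₁)` — the disc of (b) is literally the hole part of the
certified slab. No flow, no IVT. -/
theorem wideAnchoring {𝓢 : Spacetime.{0} 4} {O : Set 𝓢.carrier} {d : FinalStateDecomposition 𝓢 O 2}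
    {R : Fin d.N → ℝ → ℝ} {R₀ : ℝ} (hc : Hc 𝓢 O 2 d R₀) (hs : Sm 𝓢 O d R R₀) {τ₁ : ℝ}
    (hτ₁ : d.τ₀ < τ₁) (i : Fin d.N) :
    d.chart i '' {x | d.τ₀ < (d.background i).time x.1 ∧ (d.background i).time x.1 < τ₁ ∧
        (d.background i).radius x.1 < R i τ₁} ⊆
      𝓢.metric.causalPast 𝓢.timeOrientation (certifiedSlab d R τ₁) := by
  obtain ⟨-, hb, -, -⟩ := hc
  obtain ⟨h1, -⟩ := hs
  have hR₀ : R₀ ≤ R i τ₁ := by linarith [((h1 i).2.2 τ₁).1]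
  refine (hb i (R i τ₁) τ₁ hR₀ hτ₁).trans (LorentzianMetric.causalFuture_mono ?_)
  intro m hm
  exact Or.inr (mem_iUnion.mpr ⟨i, hm⟩)

/-- **Collar points are flat-late points in the same coordinates.** A hole-`i` coordinate point with
hole time `> τ₀` on the collar `Rᵢ(t) ≤ r ≤ Rᵢ(t) + 1` is flat-charted with the same coordinates and
lab time `≥ t`: clock lag (9) gives `t ≤ x⁰`, margin (8) read contrapositively puts it outside its own
flat tube and (12)+(8) outside the others, so one atlas (6) applies. -/
theorem collar_flat {𝓢 : Spacetime.{0} 4} {O : Set 𝓢.carrier} {d : FinalStateDecomposition 𝓢 O 2}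
    {R : Fin d.N → ℝ → ℝ} {R₀ : ℝ} (hs : Sm 𝓢 O d R R₀) (i : Fin d.N)
    (x : (d.background i).domain) (ht : d.τ₀ < (d.background i).time x.1)
    (hlo : R i ((d.background i).time x.1) ≤ (d.background i).radius x.1)
    (hhi : (d.background i).radius x.1 ≤ R i ((d.background i).time x.1) + 1) :
    ∃ hy' : x.1 ∈ d.flatDomain, d.chart i x = d.flatChart ⟨x.1, hy'⟩ ∧
      (d.background i).time x.1 ≤ x.1 0 := by
  obtain ⟨-, -, -, -, -, h6, -, h8, h9, -, -, h12⟩ := hs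
  have hlag : (d.background i).time x.1 ≤ x.1 0 := h9 i x.1 ht.le (by linarith)
  have hτ₀y : d.τ₀ ≤ x.1 0 := by linarith
  have hout : ∀ j, d.excision j (x.1 0) < (d.background j).radius x.1 := by
    intro j
    by_contra hj
    push Not at hj
    have h8' : (d.background j).radius x.1 + 2 ≤ R j ((d.background j).time x.1) := h8 j x.1 hτ₀y hj
    rcases eq_or_ne j i with rfl | hji
    · linarith
    · have h12' : R j ((d.background j).time x.1) + 1 < (d.background j).radius x.1 :=
        h12 i j x.1 (Ne.symm hji) (Or.inl hτ₀y) hhi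
      linarith
  obtain ⟨hy', hEq⟩ := h6 i x.1 x.2 hτ₀y hout hhi
  exact ⟨hy', hEq, hlag⟩

/-- **REACH from BOARD** (the routing, proved; = rim-criterion's `stub_holeRouting` + BOARD): a
charted point `q ∉ F(τ₁)` is flat-late with lab time `≤ τ₁` (BOARD), or hole-late `Ψᵢx` with,
writing `t = t*ᵢ x`, `r = rᵢ x`: `t < τ₁ ∧ r < Rᵢ(τ₁)` — wide anchoring (LOOKUP); `t = τ₁ ∧ r ≤
Rᵢ(τ₁)` — on the disc; otherwise `Rᵢ(t) ≤ r` (monotone `R` when `t < τ₁`; `q ∉ F` when `t > τ₁`)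
and then collar (`collar_flat`) or far leaf (SEAMED (10)) make `q` a flat-late point whose lab time
is `≤ τ₁` because `q ∉ F` — BOARD again. Clauses: Hc (b); Sm (1)-monotone, (6), (8), (9), (10), (12). -/
theorem chartedReach_of_flatBoarding (hB : FlatBoarding) : ChartedReach := by
  intro 𝓢 O d R R₀ hc hs τ₁ hτ₁ q hq
  obtain ⟨hq, hqF⟩ := hq
  -- flat-late representatives: in `F`, or BOARD
  have flat : ∀ (y : d.flatDomain), d.τ₀ < y.1 0 → d.flatChart y ∉ certifiedLate d R τ₁ →
      d.flatChart y ∈ 𝓢.metric.causalPast 𝓢.timeOrientation (certifiedSlab d R τ₁) := by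
    intro y hy hyF
    by_cases h : τ₁ < y.1 0
    · have hmem : d.flatChart y ∈ certifiedLate d R τ₁ := Or.inl ⟨y, h, rfl⟩
      exact (hyF hmem).elim
    · exact hB 𝓢 O d R R₀ hc hs τ₁ hτ₁ y hy (not_lt.mp h)
  rcases hq with hq | hq
  · -- radiation zone
    obtain ⟨y, hy, rfl⟩ := hq
    exact flat y hy hqF
  · -- hole region `i`
    obtain ⟨i, hqi⟩ := mem_iUnion.mp hq
    obtain ⟨x, hxt, rfl⟩ := hqi
    have hxt' : d.τ₀ < (d.background i).time x.1 := hxt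
    have hmono : Monotone (R i) := (hs.1 i).1
    by_cases hA : (d.background i).time x.1 < τ₁ ∧ (d.background i).radius x.1 < R i τ₁
    · -- LOOKUP: wide anchoring
      exact wideAnchoring hc hs hτ₁ i ⟨x, ⟨hxt', hA.1, hA.2⟩, rfl⟩
    · by_cases hD : (d.background i).time x.1 = τ₁ ∧ (d.background i).radius x.1 ≤ R i τ₁
      · -- on the disc
        refine LorentzianMetric.subset_causalPast _ _ _ (Or.inr (mem_iUnion.mpr ⟨i, x, ?_, rfl⟩))
        exact ⟨hD.1, hD.2⟩
      · -- `Rᵢ(t) ≤ r`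
        have hlo : R i ((d.background i).time x.1) ≤ (d.background i).radius x.1 := by
          rcases lt_trichotomy ((d.background i).time x.1) τ₁ with hlt | heq | hgt
          · have h1 : R i τ₁ ≤ (d.background i).radius x.1 := by
              by_contra h; push Not at h; exact hA ⟨hlt, h⟩
            exact (hmono hlt.le).trans h1
          · have h1 : R i τ₁ < (d.background i).radius x.1 := by
              by_contra h; push Not at h; exact hD ⟨heq, h⟩
            rw [heq]; exact h1.le
          · by_contra h; push Not at h
            exact hqF (Or.inr (mem_iUnion.mpr ⟨i, x, ⟨hgt, h.le⟩, rfl⟩))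
        by_cases hcol : (d.background i).radius x.1 ≤ R i ((d.background i).time x.1) + 1
        · -- collar: flat-late in the same coordinates
          obtain ⟨hy', hEq, hlag⟩ := collar_flat hs i x hxt' hlo hcol
          rw [hEq] at hqF ⊢
          exact flat ⟨x.1, hy'⟩ (lt_of_lt_of_le hxt' hlag) hqF
        · -- far leaf: in the radiation zone by SEAMED (10)
          push Not at hcol
          obtain ⟨-, -, -, -, -, -, -, -, -, h10, -, -⟩ := hs
          have hfar : d.chart i x ∈ d.chart i '' {x | d.τ₀ < (d.background i).time x.1 ∧
              R i ((d.background i).time x.1) + 1 < (d.background i).radius x.1} :=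
            ⟨x, ⟨hxt', hcol⟩, rfl⟩
          have hrad : d.chart i x ∈ d.radiationZone := h10 i hfar
          obtain ⟨y, hy, hyEq⟩ := hrad
          rw [← hyEq] at hqF ⊢
          exact flat y hy hqF

/-! ### The sibling lines' remaining stubs, verbatim, DERIVED here (consolidation certificates)

After these, every registered stub of `Lines/rim-criterion.lean` (4) and `Lines/abstract-exterior.lean`
(2) is either one of this file's two stubs or a theorem of this file: rim `stub_rim` = STUB 2;
rim `stub_tubeRide` = `tubeRide` (proved); rim `stub_flatBoarding` ⇐ STUB 1
(`rim_flatBoarding_of_firstContact`); rim `stub_holeRouting` = `rim_holeRouting` (proved outright);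
abstract-exterior `stub_firstContact` ⇐ STUB 1 (`firstContact_of_stub`); abstract-exterior
`stub_frontier` ⇐ STUB 2 (`frontierBelowSlab_of_rim`). -/

/-- abstract-exterior's `FirstContact` (bundle form, verbatim statement over the identical copies
`Hc`/`Sm`). -/
def FirstContact : Prop :=
  ∀ (𝓢 : Spacetime.{0} 4) (O : Set 𝓢.carrier) (d : FinalStateDecomposition 𝓢 O 2)
    (R : Fin d.N → ℝ → ℝ) (R₀ : ℝ), Hc 𝓢 O 2 d R₀ → Sm 𝓢 O d R R₀ →
    ∀ τ₁ : ℝ, d.τ₀ < τ₁ → ∀ y : d.flatDomain, d.τ₀ < y.1 0 → y.1 0 ≤ τ₁ →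
      d.flatChart y ∈ 𝓢.metric.causalPast 𝓢.timeOrientation
          (d.flatChart '' (Minkowski.backgroundOn d.flatDomain).timeSlab τ₁) ∨
      ∃ (c : d.flatDomain) (k : Fin d.N), d.τ₀ < c.1 0 ∧ c.1 0 ≤ τ₁ ∧
        (d.background k).radius c.1 ≤ R k ((d.background k).time c.1) ∧
        d.flatChart y ∈ 𝓢.metric.causalPast 𝓢.timeOrientation {d.flatChart c}

/-- **abstract-exterior's `stub_firstContact` from STUB 1** (projection of the bundles). -/
theorem firstContact_of_stub (h : Registered.stub_firstContact) : FirstContact :=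
  fun 𝓢 O d R _ hc hs τ₁ _ y hy₀ hy₁ ↦
    h 𝓢 O d R hc.2.2.2 (fun i ↦ (hs.1 i).2.1) hs.2.2.2.2.2.2.2.1 τ₁ y hy₀ hy₁

/-- **rim-criterion's `stub_flatBoarding` (verbatim statement) from STUB 1** — no ride is needed:
the contact point itself is a ride-able certified tube point (`contact_mem_rideable`). -/
theorem rim_flatBoarding_of_firstContact (h : Registered.stub_firstContact)
    (𝓢 : Spacetime.{0} 4) (O : Set 𝓢.carrier)
    (d : FinalStateDecomposition 𝓢 O 2) (R : Fin d.N → ℝ → ℝ) (R₀ : ℝ)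
    (ha : ∀ i, 100 * d.mass i ≤ R₀)
    (hd : ∀ y : d.flatDomain, d.τ₀ < y.1 0 →
      𝓢.timeOrientation.IsFutureDirected (mfderiv 𝓘(ℝ, E4) (𝓡 4) d.flatChart y (E4.basisVector 0)))
    (h1 : ∀ i, Continuous (R i) ∧ ∀ s, R₀ + 4 ≤ R i s ∧ R₀ ≤ d.excision i s)
    (h6 : ∀ i (y : E4) (hy : y ∈ (d.background i).domain), d.τ₀ ≤ y 0 →
      (∀ j, d.excision j (y 0) < (d.background j).radius y) →
      (d.background i).radius y ≤ R i ((d.background i).time y) + 1 →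
      ∃ hy' : y ∈ d.flatDomain, d.chart i ⟨y, hy⟩ = d.flatChart ⟨y, hy'⟩)
    (h7 : ∀ y : d.flatDomain, d.τ₀ ≤ y.1 0 → ∀ j, d.excision j (y.1 0) < (d.background j).radius y.1)
    (h8 : ∀ j (y : E4), d.τ₀ ≤ y 0 → (d.background j).radius y ≤ d.excision j (y 0) →
      (d.background j).radius y + 2 ≤ R j ((d.background j).time y))
    (h9 : ∀ j (y : E4), d.τ₀ ≤ (d.background j).time y →
      (d.background j).radius y ≤ R j ((d.background j).time y) + 2 → (d.background j).time y ≤ y 0)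
    (τ₁ : ℝ) (y : d.flatDomain) (hy₀ : d.τ₀ < y.1 0) (hy₁ : y.1 0 ≤ τ₁) :
    d.flatChart y ∈ 𝓢.metric.causalPast 𝓢.timeOrientation
      (certifiedSlab d R τ₁ ∪ ⋃ j, d.chart j '' {x | (d.τ₀ ≤ (d.background j).time x.1 ∨ d.τ₀ ≤ x.1 0) ∧
        R₀ ≤ (d.background j).radius x.1 ∧
        (d.background j).radius x.1 ≤ R j ((d.background j).time x.1) ∧
        (d.background j).time x.1 ≤ τ₁}) := by
  rcases h 𝓢 O d R hd (fun i ↦ (h1 i).1) h8 τ₁ y hy₀ hy₁ with hslab | ⟨c, k, hc₀, hc₁, hrR, hyc⟩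
  · refine LorentzianMetric.causalFuture_mono ?_ hslab
    intro z hz
    exact Or.inl (Or.inl hz)
  · have hcT : d.flatChart c ∈ rideable d R R₀ τ₁ :=
      contact_mem_rideable d R R₀ ha (fun i s ↦ ((h1 i).2 s).2) h6 h7 h9 τ₁ c k hc₀ hc₁ hrR
    have hcST : d.flatChart c ∈ certifiedSlab d R τ₁ ∪ rideable d R R₀ τ₁ := Set.mem_union_right _ hcT
    exact LorentzianMetric.causalFuture_mono (singleton_subset_iff.mpr hcST) hyc

set_option linter.unusedVariables false in
/-- **rim-criterion's `stub_holeRouting` (verbatim statement), PROVED** — the hole-side routing is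
flow-free case analysis (this is where the wide-anchoring lever made the hole side trivial): a
hole-late `Ψᵢ x ∉ F(τ₁)` is on the slab, or anchorable (`t < τ₁ ∧ r < Rᵢ(τ₁)`), or a flat-late point
with lab time `≤ τ₁` (collar by (9), (8), (12), (6); far leaf by (10)). -/
theorem rim_holeRouting (𝓢 : Spacetime.{0} 4) (O : Set 𝓢.carrier)
    (d : FinalStateDecomposition 𝓢 O 2) (R : Fin d.N → ℝ → ℝ) (R₀ : ℝ)
    (hmono : ∀ i, Monotone (R i))
    (h6 : ∀ i (y : E4) (hy : y ∈ (d.background i).domain), d.τ₀ ≤ y 0 →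
      (∀ j, d.excision j (y 0) < (d.background j).radius y) →
      (d.background i).radius y ≤ R i ((d.background i).time y) + 1 →
      ∃ hy' : y ∈ d.flatDomain, d.chart i ⟨y, hy⟩ = d.flatChart ⟨y, hy'⟩)
    (h8 : ∀ j (y : E4), d.τ₀ ≤ y 0 → (d.background j).radius y ≤ d.excision j (y 0) →
      (d.background j).radius y + 2 ≤ R j ((d.background j).time y))
    (h9 : ∀ j (y : E4), d.τ₀ ≤ (d.background j).time y →
      (d.background j).radius y ≤ R j ((d.background j).time y) + 2 → (d.background j).time y ≤ y 0)
    (h10 : ∀ j, d.chart j '' {x | d.τ₀ < (d.background j).time x.1 ∧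
      R j ((d.background j).time x.1) + 1 < (d.background j).radius x.1} ⊆ d.radiationZone)
    (h12 : ∀ j j' (y : E4), j ≠ j' → (d.τ₀ ≤ y 0 ∨ d.τ₀ ≤ (d.background j).time y) →
      (d.background j).radius y ≤ R j ((d.background j).time y) + 1 →
      R j' ((d.background j').time y) + 1 < (d.background j').radius y)
    (τ₁ : ℝ) (i : Fin d.N) (x : (d.background i).domain)
    (hlate : d.τ₀ < (d.background i).time x.1) (hF : d.chart i x ∉ certifiedLate d R τ₁) :
    d.chart i x ∈ certifiedSlab d R τ₁ ∨
      ((d.background i).time x.1 < τ₁ ∧ (d.background i).radius x.1 < R i τ₁) ∨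
      ∃ y : d.flatDomain, d.τ₀ < y.1 0 ∧ y.1 0 ≤ τ₁ ∧ d.chart i x = d.flatChart y := by
  by_cases hA : (d.background i).time x.1 < τ₁ ∧ (d.background i).radius x.1 < R i τ₁
  · exact Or.inr (Or.inl hA)
  by_cases hD : (d.background i).time x.1 = τ₁ ∧ (d.background i).radius x.1 ≤ R i τ₁
  · exact Or.inl (Or.inr (mem_iUnion.mpr ⟨i, x, ⟨hD.1, hD.2⟩, rfl⟩))
  -- `Rᵢ(t) ≤ r`
  have hlo : R i ((d.background i).time x.1) ≤ (d.background i).radius x.1 := by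
    rcases lt_trichotomy ((d.background i).time x.1) τ₁ with hlt | heq | hgt
    · have h1 : R i τ₁ ≤ (d.background i).radius x.1 := by
        by_contra h; push Not at h; exact hA ⟨hlt, h⟩
      exact (hmono i hlt.le).trans h1
    · have h1 : R i τ₁ < (d.background i).radius x.1 := by
        by_contra h; push Not at h; exact hD ⟨heq, h⟩
      rw [heq]; exact h1.le
    · by_contra h; push Not at h
      exact hF (Or.inr (mem_iUnion.mpr ⟨i, x, ⟨hgt, h.le⟩, rfl⟩))
  right; right
  by_cases hcol : (d.background i).radius x.1 ≤ R i ((d.background i).time x.1) + 1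
  · -- collar: flat-late in the same coordinates
    have hlag : (d.background i).time x.1 ≤ x.1 0 := h9 i x.1 hlate.le (by linarith)
    have hτ₀y : d.τ₀ ≤ x.1 0 := by linarith
    have hout : ∀ j, d.excision j (x.1 0) < (d.background j).radius x.1 := by
      intro j
      by_contra hj
      push Not at hj
      have h8' : (d.background j).radius x.1 + 2 ≤ R j ((d.background j).time x.1) := h8 j x.1 hτ₀y hj
      rcases eq_or_ne j i with rfl | hji
      · linarith
      · have h12' : R j ((d.background j).time x.1) + 1 < (d.background j).radius x.1 :=
          h12 i j x.1 (Ne.symm hji) (Or.inl hτ₀y) hcol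
        linarith
    obtain ⟨hy', hEq⟩ := h6 i x.1 x.2 hτ₀y hout hcol
    have hEq' : d.chart i x = d.flatChart ⟨x.1, hy'⟩ := hEq
    refine ⟨⟨x.1, hy'⟩, lt_of_lt_of_le hlate hlag, ?_, hEq'⟩
    by_contra hgt
    push Not at hgt
    apply hF
    rw [hEq']
    exact Or.inl ⟨⟨x.1, hy'⟩, hgt, rfl⟩
  · -- far leaf: in the radiation zone by SEAMED (10)
    push Not at hcol
    have hrad : d.chart i x ∈ d.radiationZone := h10 i ⟨x, ⟨hlate, hcol⟩, rfl⟩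
    obtain ⟨y, hy, hyEq⟩ := hrad
    refine ⟨y, hy, ?_, hyEq.symm⟩
    by_contra hgt
    push Not at hgt
    apply hF
    rw [← hyEq]
    exact Or.inl ⟨y, hgt, rfl⟩

/-! ### The certified late region is open (lateral walls are flat-late), proved -/

/-- Images of open subsets of the late region under a late chart are open (the chart restricted to
the late region is an open embedding). -/
theorem isOpen_image_of_isLateChart {𝓢 : Spacetime.{0} 4} {B : ModelBackground}
    {𝒟 : Set 𝓢.carrier} {τ₀ : ℝ} {Ψ : B.domain → 𝓢.carrier} (hΨ : 𝓢.IsLateChart B 𝒟 τ₀ Ψ)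
    {U : Set B.domain} (hU : IsOpen U) (hUl : U ⊆ B.lateRegion τ₀) : IsOpen (Ψ '' U) := by
  have h := hΨ.isOpenEmbedding.isOpenMap (Subtype.val ⁻¹' U) (hU.preimage continuous_subtype_val)
  have hEq : (B.lateRegion τ₀).restrict Ψ '' (Subtype.val ⁻¹' U) = Ψ '' U := by
    ext z
    constructor
    · rintro ⟨⟨x, hxl⟩, hxU, rfl⟩
      exact ⟨x, hxU, rfl⟩
    · rintro ⟨x, hxU, rfl⟩
      exact ⟨⟨x, hUl hxU⟩, hxU, rfl⟩
  rw [← hEq]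
  exact h

/-- **`CertifiedLateIsOpen` holds** (proof from `SketchIdeator3.certifiedLateIsOpen_holds`,
planner-cruxidea-stmt-FinalStateConjecture-13551-3-0): lateral walls `r = Rⱼ(t)`, `t > τ₁` are
flat-late by `collar_flat`; the rest is open embeddings of open sets. Clauses: Sm (1)-continuity,
(6), (8), (9), (12). -/
theorem certifiedLateIsOpen_holds : CertifiedLateIsOpen := by
  intro 𝓢 O d R R₀ hs τ₁ hτ₁
  have hS1 := hs.1
  -- continuity of the clocks and radii
  have hc0 : Continuous fun y : E4 ↦ y 0 := PiLp.continuous_apply 2 _ 0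
  have ht : ∀ i, Continuous fun x : E4 ↦ (d.background i).time x := fun i ↦
    hc0.comp (continuous_poincareInv _ _)
  have hr : ∀ i, Continuous fun x : E4 ↦ (d.background i).radius x := fun i ↦
    (Kerr.continuous_radius _).comp (continuous_poincareInv _ _)
  -- the open pieces
  have hF₀ : IsOpen (d.flatChart '' (Minkowski.backgroundOn d.flatDomain).lateRegion τ₁) := by
    refine isOpen_image_of_isLateChart d.isLateChart_flat ?_ fun y hy ↦ lt_trans hτ₁ hy
    exact isOpen_lt continuous_const (hc0.comp continuous_subtype_val)
  have hFi : ∀ i, IsOpen (d.chart i '' {x | τ₁ < (d.background i).time x.1 ∧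
      (d.background i).radius x.1 < R i ((d.background i).time x.1)}) := by
    intro i
    refine isOpen_image_of_isLateChart (d.isLateChart i) ?_ fun x hx ↦ lt_trans hτ₁ hx.1
    exact (isOpen_lt continuous_const ((ht i).comp continuous_subtype_val)).and
      (isOpen_lt ((hr i).comp continuous_subtype_val)
        ((hS1 i).2.1.comp ((ht i).comp continuous_subtype_val)))
  -- `certifiedLate` is the union of the open pieces: lateral walls are flat-late
  have hEq : certifiedLate d R τ₁ =
      d.flatChart '' (Minkowski.backgroundOn d.flatDomain).lateRegion τ₁ ∪
        ⋃ i, d.chart i '' {x | τ₁ < (d.background i).time x.1 ∧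
          (d.background i).radius x.1 < R i ((d.background i).time x.1)} := by
    refine Set.Subset.antisymm ?_ ?_
    · rintro z (hz | hz)
      · exact Or.inl hz
      · obtain ⟨j, x, ⟨hxt, hxr⟩, rfl⟩ := Set.mem_iUnion.mp hz
        rcases lt_or_eq_of_le hxr with hlt | heq
        · exact Or.inr (Set.mem_iUnion.mpr ⟨j, x, ⟨hxt, hlt⟩, rfl⟩)
        · -- lateral wall point
          left
          obtain ⟨hy', hEqΦ, hlag⟩ := collar_flat hs j x (lt_trans hτ₁ hxt) heq.ge (by linarith)
          refine ⟨⟨x.1, hy'⟩, ?_, hEqΦ.symm⟩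
          show τ₁ < x.1 0
          linarith
    · rintro z (hz | hz)
      · exact Or.inl hz
      · obtain ⟨j, x, ⟨hxt, hxr⟩, rfl⟩ := Set.mem_iUnion.mp hz
        exact Or.inr (Set.mem_iUnion.mpr ⟨j, x, ⟨hxt, hxr.le⟩, rfl⟩)
  rw [hEq]
  exact hF₀.union (isOpen_iUnion hFi)

/-! ### Abstract first-entry covering and causal convexity of the exterior, proved -/

/-- **Abstract first-entry covering lemma** (metric-free; proof from
`SketchIdeator3.firstEntryCovering_holds`). In any spacetime: if `F` is open, `F ⊆ C ⊆ O ⊆ I⁻(C)`, `O`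
is causally convex, every point of `C \ F` and every point of `(closure F ∩ O) \ F` lies in `J⁻(S)`,
then `O \ F ⊆ J⁻(S)`: `p ≪ q ∈ C`; if `q ∈ F`, the first parameter of the timelike curve in `F` gives
`q* ∈ closure F \ F`, `q* ∈ O` by causal convexity, `p ≤ q* ∈ J⁻(S)`, and `J⁻ ∘ J⁻ = J⁻`. -/
theorem firstEntryCovering (𝓢 : Spacetime.{0} 4) (O C F S : Set 𝓢.carrier)
    (hF : IsOpen F) (hCO : C ⊆ O)
    (hOI : O ⊆ 𝓢.metric.chronologicalPast 𝓢.timeOrientation C)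
    (hconv : ∀ p ∈ O, ∀ q ∈ O, 𝓢.metric.causalFuture 𝓢.timeOrientation {p} ∩
        𝓢.metric.causalPast 𝓢.timeOrientation {q} ⊆ O)
    (hCF : C \ F ⊆ 𝓢.metric.causalPast 𝓢.timeOrientation S)
    (hfront : (closure F ∩ O) \ F ⊆ 𝓢.metric.causalPast 𝓢.timeOrientation S) :
    O \ F ⊆ 𝓢.metric.causalPast 𝓢.timeOrientation S := by
  intro p hp
  obtain ⟨hpO, hpF⟩ := hp
  -- `p ≪ c` for some `c ∈ C`
  have hpI : p ∈ 𝓢.metric.chronologicalFuture 𝓢.timeOrientation.reverse C := hOI hpO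
  rw [LorentzianMetric.chronologicalFuture_eq_biUnion] at hpI
  simp only [Set.mem_iUnion, exists_prop] at hpI
  obtain ⟨c, hcC, hpc⟩ := hpI
  by_cases hcF : c ∈ F
  swap
  · exact causalPast_trans (LorentzianMetric.chronologicalFuture_subset_causalFuture 𝓢.metric
      𝓢.timeOrientation.reverse {c} hpc) (hCF ⟨hcC, hcF⟩)
  -- the timelike curve from `p` to `c ∈ F`
  have hcp : c ∈ 𝓢.metric.chronologicalFuture 𝓢.timeOrientation {p} :=
    LorentzianMetric.mem_chronologicalFuture_of_mem_chronologicalPast hpc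
  obtain ⟨p', hp', γ, a, b, hab, hγ, hγa, hγb⟩ := hcp
  rw [Set.mem_singleton_iff] at hp'
  have hγa' : γ a = p := hγa.trans hp'
  have hγc : ∀ s ∈ Set.Icc a b, ContinuousAt γ s := fun s hs ↦ (hγ s hs).1.continuousAt
  -- first entry: infimum of the parameters mapped into `F`
  let A : Set ℝ := {s | s ∈ Set.Icc a b ∧ γ s ∈ F}
  have hbA : b ∈ A := ⟨Set.right_mem_Icc.mpr hab.le, by show γ b ∈ F; rw [hγb]; exact hcF⟩
  have hAne : A.Nonempty := ⟨b, hbA⟩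
  have hAbdd : BddBelow A := ⟨a, fun s hs ↦ hs.1.1⟩
  have hs₀b : sInf A ≤ b := csInf_le hAbdd hbA
  have has₀ : a ≤ sInf A := le_csInf hAne fun s hs ↦ hs.1.1
  have hs₀I : sInf A ∈ Set.Icc a b := ⟨has₀, hs₀b⟩
  -- `γ (sInf A) ∈ closure F`
  have hcl : γ (sInf A) ∈ closure F := by
    have h1 : sInf A ∈ closure A := csInf_mem_closure hAne hAbdd
    have h2 : γ (sInf A) ∈ closure (γ '' A) :=
      ContinuousWithinAt.mem_closure_image (hγc _ hs₀I).continuousWithinAt h1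
    refine closure_mono ?_ h2
    rintro _ ⟨s, hs, rfl⟩
    exact hs.2
  -- `γ (sInf A) ∉ F` (openness of `F`; at `a` because `p ∉ F`)
  have hnF : γ (sInf A) ∉ F := by
    intro hF₀
    have hne : a ≠ sInf A := by
      intro h
      rw [← h, hγa'] at hF₀
      exact hpF hF₀
    have has₀' : a < sInf A := lt_of_le_of_ne has₀ hne
    have hnhds : γ ⁻¹' F ∈ 𝓝 (sInf A) := (hγc _ hs₀I).preimage_mem_nhds (hF.mem_nhds hF₀)
    obtain ⟨ε, hε, hball⟩ := Metric.mem_nhds_iff.mp hnhds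
    obtain ⟨s₁, hs₁a, hs₁ε, hs₁lt⟩ : ∃ s₁, a ≤ s₁ ∧ sInf A - ε / 2 ≤ s₁ ∧ s₁ < sInf A :=
      ⟨max a (sInf A - ε / 2), le_max_left _ _, le_max_right _ _, max_lt has₀' (by linarith)⟩
    have hs₁A : s₁ ∈ A := by
      refine ⟨⟨hs₁a, hs₁lt.le.trans hs₀b⟩, ?_⟩
      apply hball
      rw [Metric.mem_ball, Real.dist_eq, abs_sub_lt_iff]
      constructor <;> linarith
    exact absurd (csInf_le hAbdd hs₁A) (not_le.mpr hs₁lt)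
  -- `p ≤ γ (sInf A)`
  have hps₀ : p ∈ 𝓢.metric.causalPast 𝓢.timeOrientation {γ (sInf A)} := by
    rcases eq_or_lt_of_le has₀ with h | h
    · rw [← h, hγa']
      exact LorentzianMetric.subset_causalPast _ _ _ (Set.mem_singleton p)
    · exact LorentzianMetric.mem_causalPast_singleton_iff.mpr (Or.inr ⟨p, Set.mem_singleton p,
        γ, a, sInf A, h, (hγ.mono (Set.Icc_subset_Icc le_rfl hs₀b)).isFutureCausalCurveOn,
        hγa', rfl⟩)
  -- `γ (sInf A) ≤ c`
  have hs₀c : γ (sInf A) ∈ 𝓢.metric.causalPast 𝓢.timeOrientation {c} := by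
    rcases eq_or_lt_of_le hs₀b with h | h
    · rw [h, hγb]
      exact LorentzianMetric.subset_causalPast _ _ _ (Set.mem_singleton c)
    · exact LorentzianMetric.mem_causalPast_singleton_iff.mpr (Or.inr ⟨γ (sInf A),
        Set.mem_singleton _, γ, sInf A, b, h,
        (hγ.mono (Set.Icc_subset_Icc has₀ le_rfl)).isFutureCausalCurveOn, rfl, hγb⟩)
  -- causal convexity: the first-entry point lies in `O`
  have hs₀O : γ (sInf A) ∈ O :=
    hconv p hpO c (hCO hcC) ⟨LorentzianMetric.mem_causalPast_singleton_iff.mp hps₀, hs₀c⟩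
  -- frontier hypothesis and `J⁻ ∘ J⁻ = J⁻`
  exact causalPast_trans hps₀ (hfront ⟨⟨hcl, hs₀O⟩, hnF⟩)

/-- **The two properties of `O = exteriorOf 𝒟 U = J⁺(ι X) ∩ I⁻(U)` the line uses** (proof from
`SketchIdeator3.exteriorOf_causallyConvex`): `O ⊆ I⁻(U)` and causal convexity `J⁺(p) ∩ J⁻(q) ⊆ O`
for `p, q ∈ O` (transitivity of `J⁺`; push-up `x ≤ q ≪ c ⇒ x ≪ c`; time duality). This is the only
place the shape `O = exteriorOf` enters; no field equation, maximality or admissibility is used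
(Disproof §2). -/
theorem exteriorOf_causallyConvex {X : Type} [TopologicalSpace X] [ChartedSpace E3 X]
    [IsManifold (𝓡 3) ∞ X] [ConnectedSpace X] {D : InitialDataSet (𝓡 3) X}
    (𝒟 : VacuumCauchyDevelopment D) (U : Set 𝒟.carrier) :
    (exteriorOf 𝒟.toCauchyDevelopment U ⊆
        𝒟.toSpacetime.metric.chronologicalPast 𝒟.toSpacetime.timeOrientation U) ∧
    ∀ p ∈ exteriorOf 𝒟.toCauchyDevelopment U, ∀ q ∈ exteriorOf 𝒟.toCauchyDevelopment U,
      𝒟.toSpacetime.metric.causalFuture 𝒟.toSpacetime.timeOrientation {p} ∩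
          𝒟.toSpacetime.metric.causalPast 𝒟.toSpacetime.timeOrientation {q} ⊆
        exteriorOf 𝒟.toCauchyDevelopment U := by
  refine ⟨Set.inter_subset_right, ?_⟩
  rintro p ⟨hpS, -⟩ q ⟨-, hqU⟩ x ⟨hxp, hxq⟩
  have hn2 : (2 : WithTop ℕ∞) ≤ ((⊤ : ℕ∞) : WithTop ℕ∞) := WithTop.coe_le_coe.mpr le_top
  have hn1 : (1 : WithTop ℕ∞) ≤ ((⊤ : ℕ∞) : WithTop ℕ∞) := WithTop.coe_le_coe.mpr le_top
  refine ⟨?_, ?_⟩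
  · -- `x ∈ J⁺(ι X)` : `J⁺(J⁺ S) = J⁺ S`
    have hx : x ∈ 𝒟.toSpacetime.metric.causalFuture 𝒟.toSpacetime.timeOrientation
        (𝒟.toSpacetime.metric.causalFuture 𝒟.toSpacetime.timeOrientation (range 𝒟.embed)) :=
      LorentzianMetric.causalFuture_mono (Set.singleton_subset_iff.mpr hpS) hxp
    rwa [LorentzianMetric.causalFuture_causalFuture_eq hn2] at hx
  · -- `x ∈ I⁻(U)` : `q ≪⁻ c ∈ U`, `x ≤ q ≪ c ⇒ x ≪ c`
    have hqU' : q ∈ 𝒟.toSpacetime.metric.chronologicalFuture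
        𝒟.toSpacetime.timeOrientation.reverse U := hqU
    rw [LorentzianMetric.chronologicalFuture_eq_biUnion] at hqU'
    simp only [Set.mem_iUnion, exists_prop] at hqU'
    obtain ⟨c, hcU, hqc⟩ := hqU'
    have hcq : c ∈ 𝒟.toSpacetime.metric.chronologicalFuture 𝒟.toSpacetime.timeOrientation {q} :=
      LorentzianMetric.mem_chronologicalFuture_of_mem_chronologicalPast hqc
    have hqx : q ∈ 𝒟.toSpacetime.metric.causalFuture 𝒟.toSpacetime.timeOrientation {x} :=
      LorentzianMetric.mem_causalPast_singleton_iff.mp hxq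
    have hcx : c ∈ 𝒟.toSpacetime.metric.chronologicalFuture 𝒟.toSpacetime.timeOrientation {x} :=
      LorentzianMetric.mem_chronologicalFuture_of_mem_causalFuture hn1 hqx hcq
    have hxc := LorentzianMetric.mem_chronologicalPast_of_mem_chronologicalFuture hcx
    show x ∈ 𝒟.toSpacetime.metric.chronologicalFuture 𝒟.toSpacetime.timeOrientation.reverse U
    rw [LorentzianMetric.chronologicalFuture_eq_biUnion]
    simp only [Set.mem_iUnion, exists_prop]
    exact ⟨c, hcU, hxc⟩

/-- **The spacetime-level conclusion from the two halves**: for a decomposition `d` of a region `O`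
that is cofinal under the charts and causally convex, `Sm`, FRONTIER and REACH give
`HasExhaustiveCharts d` (clause (i) is SEAMED (2) with the given radii `R`). -/
theorem hasExhaustiveCharts_of_reach_frontier {𝓢 : Spacetime.{0} 4} {O : Set 𝓢.carrier}
    (d : FinalStateDecomposition 𝓢 O 2) (R : Fin d.N → ℝ → ℝ) (R₀ : ℝ)
    (hOI : O ⊆ 𝓢.metric.chronologicalPast 𝓢.timeOrientation d.charted)
    (hconv : ∀ p ∈ O, ∀ q ∈ O, 𝓢.metric.causalFuture 𝓢.timeOrientation {p} ∩
        𝓢.metric.causalPast 𝓢.timeOrientation {q} ⊆ O)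
    (hs : Sm 𝓢 O d R R₀)
    (hFront : ∀ τ₁ : ℝ, d.τ₀ < τ₁ →
      (closure (certifiedLate d R τ₁) ∩ O) \ certifiedLate d R τ₁ ⊆
        𝓢.metric.causalPast 𝓢.timeOrientation (certifiedSlab d R τ₁))
    (hReach : ∀ τ₁ : ℝ, d.τ₀ < τ₁ →
      d.charted \ certifiedLate d R τ₁ ⊆ 𝓢.metric.causalPast 𝓢.timeOrientation (certifiedSlab d R τ₁)) :
    HasExhaustiveCharts d := by
  refine ⟨R, hs.2.1, fun τ₁ hτ₁ ↦ ?_⟩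
  exact firstEntryCovering 𝓢 O d.charted (certifiedLate d R τ₁) (certifiedSlab d R τ₁)
    (certifiedLateIsOpen_holds 𝓢 O d R R₀ hs τ₁ hτ₁) d.charted_subset hOI hconv
    (hReach τ₁ hτ₁) (hFront τ₁ hτ₁)

/-! ## §4 The skeleton: `SeamedChartsExhaust` from the two registered stubs -/

/-- **`SeamedChartsExhaust` from the two stubs** (kernel-checked, no `sorry` here): unfold the crux
(`crux_iff`), instantiate at `𝓢 := 𝒟.toSpacetime`, discharge cofinality and causal convexity of
`O = exteriorOf 𝒟 d.charted` (`exteriorOf_causallyConvex`), REACH from STUB 1 through boarding and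
routing (`flatBoarding_of_firstContact`, `chartedReach_of_flatBoarding`), FRONTIER from STUB 2
through the ride (`frontierBelowSlab_of_rim`). -/
theorem SeamedChartsExhaust_of (hContact : Registered.stub_firstContact)
    (hRim : Registered.stub_rim) :
    _root_.Summit.FinalStateConjecture.FinalStateConjecture.Theses.StarvedNecks.SeamedChartsExhaust := by
  rw [crux_iff]
  intro X _ _ _ _ D hD 𝒟 h𝒟 O d R R₀ hO hc hs
  obtain ⟨hOI, hconv⟩ := exteriorOf_causallyConvex 𝒟 d.charted
  rw [← hO] at hOI hconv
  exact hasExhaustiveCharts_of_reach_frontier d R R₀ hOI hconv hs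
    (frontierBelowSlab_of_rim hRim 𝒟.toSpacetime O d R R₀ hc hs)
    (chartedReach_of_flatBoarding (flatBoarding_of_firstContact hContact) 𝒟.toSpacetime O d R R₀ hc hs)

/-- Wiring check (an `example`, so that `SeamedChartsExhaust_of` stays the unique theorem of this
file concluding the crux): the registered stub theorems feed the composition as stated. -/
example : _root_.Summit.FinalStateConjecture.FinalStateConjecture.Theses.StarvedNecks.SeamedChartsExhaust :=
  SeamedChartsExhaust_of stub_firstContact stub_rim

/-! ## §5 Disproof used — kernel-checked: HonestCore (d) enters exactly at STUB 1 -/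

section NegativeCheck

open Summit.FinalStateConjecture.FinalStateConjecture.Theorems.SeamedChartsExhaust.Negative

/-- The landed negative model this skeleton is checked against (imported; named here so that the
check is part of elaboration): the time-reversed flat chart on Minkowski spacetime satisfies `Hc`
(a)–(c) and all of SEAMED and violates exhaustion (`Negative/ReversedFlatChart.lean`, p73375; packaged
as `Negative.not_forall_hasExhaustiveCharts_without_futureOrientation`, `Negative/WithoutFutureOrientation.lean`,
p73931). -/
example := @ReversedModel.not_hasExhaustiveCharts_decomp

/-- View a point of `Minkowski.spacetime` as a point of `E4` (the carrier IS `E4`). -/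
abbrev toE4 (x : Minkowski.spacetime.carrier) : E4 := x

/-- **STUB 1 genuinely needs `Hc` (d).** The statement of `stub_firstContact` with the hypothesis
`hd` DELETED is false: in the landed negative model `ReversedModel.decomp` (Minkowski spacetime,
`N = 0`, `τ₀ = 0`, flat chart the time reversal `Φ(y) = (−y⁰, y̲)` on `⊤`; the other two hypotheses
`hR`, `h8` are vacuous there, `Fin 0`) take `τ₁ = 1` and the flat-late point `y = (1/2, 0, 0, 0)`: the
left disjunct says `Φ(y) = (−1/2, 0) ∈ J⁻(Φ(slab)) = J⁻({x⁰ = −1}) ⊆ {x⁰ ≤ −1}`, false; the right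
disjunct needs a hole index `k : Fin 0`. Consistent with `not_forall_hasExhaustiveCharts_without_futureOrientation`:
the load-bearing clause is consumed at this stub and only here. -/
theorem stub_firstContact_false_without_hd :
    ¬ ∀ (𝓢 : Spacetime.{0} 4) (O : Set 𝓢.carrier) (d : FinalStateDecomposition 𝓢 O 2)
        (R : Fin d.N → ℝ → ℝ),
      (∀ i, Continuous (R i)) →
      (∀ j (y : E4), d.τ₀ ≤ y 0 → (d.background j).radius y ≤ d.excision j (y 0) →
        (d.background j).radius y + 2 ≤ R j ((d.background j).time y)) →
      ∀ (τ₁ : ℝ) (y : d.flatDomain), d.τ₀ < y.1 0 → y.1 0 ≤ τ₁ →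
        d.flatChart y ∈ 𝓢.metric.causalPast 𝓢.timeOrientation
            (d.flatChart '' (Minkowski.backgroundOn d.flatDomain).timeSlab τ₁) ∨
          ∃ (c : d.flatDomain) (k : Fin d.N), d.τ₀ < c.1 0 ∧ c.1 0 ≤ τ₁ ∧
            (d.background k).radius c.1 ≤ R k ((d.background k).time c.1) ∧
            d.flatChart y ∈ 𝓢.metric.causalPast 𝓢.timeOrientation {d.flatChart c} := by
  intro h
  set y : E4 := (1 / 2 : ℝ) • E4.basisVector 0 with hy
  have hy0 : y 0 = 1 / 2 := by simp [hy]
  have hτ₀ : ReversedModel.decomp.τ₀ = 0 := rfl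
  have hdis := h Minkowski.spacetime ReversedModel.O ReversedModel.decomp Fin.elim0
    (fun i ↦ i.elim0) (fun j ↦ j.elim0) 1 ⟨y, trivial⟩
    (show ReversedModel.decomp.τ₀ < y 0 by rw [hτ₀, hy0]; norm_num)
    (show y 0 ≤ 1 by rw [hy0]; norm_num)
  -- the boarded point is `Φ y = T y`, with lab time `−1/2`
  have hΦ : toE4 (ReversedModel.decomp.flatChart ⟨y, trivial⟩) 0 = -(1 / 2) := by
    show ReversedModel.T y 0 = -(1 / 2)
    rw [ReversedModel.T_apply_zero, hy0]
  rcases hdis with hmem | ⟨c, k, -⟩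
  · obtain ⟨q, hq, hpq⟩ := ReversedModel.exists_mem_causalPast_singleton_of_mem_causalPast hmem
    have hle := ReversedModel.time_le_of_mem_causalPast_singleton hpq
    have hq' : q ∈ (ReversedModel.Φ '' (Minkowski.backgroundOn ⊤).timeSlab 1 : Set E4) := hq
    rw [ReversedModel.image_Φ_timeSlab] at hq'
    have hq1 : q 0 = -1 := hq'
    have hle' : toE4 (ReversedModel.decomp.flatChart ⟨y, trivial⟩) 0 ≤ q 0 := hle
    rw [hΦ] at hle'
    linarith
  · exact k.elim0

end NegativeCheck

/-! ## §6 Regression harness: the `N = 0` case of BOTH registered signatures, in EVERY spacetime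

With no hole STUB 1 is the pure `e₀`-flow (its left disjunct, from `hd` and the structure field
alone) and STUB 2 follows from SEAMED (11) alone (cf. `Triage3.frontierBelowSlab_N0`). These are unit
tests of the sign/strictness conventions of `certifiedLate` (`τ₁ < y⁰`), `certifiedSlab` (`y⁰ = τ₁`)
and of the two stub statements; they re-run unchanged against any repaired SEAMED-R, and they are the
stub-level form of the landed `Negative.hasExhaustiveCharts_of_N_eq_zero` (p74470: no counterexample
to the crux without a hole). -/

section NZero

variable (𝓢 : Spacetime.{0} 4) (O : Set 𝓢.carrier) (d : FinalStateDecomposition 𝓢 O 2)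
  (R : Fin d.N → ℝ → ℝ) (R₀ : ℝ)

/-- STUB 1 at `N = 0` in every spacetime (always the no-contact branch), from `hd` alone: flow along
the `e₀`-line from `y` (`τ₀ < y⁰ ≤ τ₁`) to the flat slab `{x⁰ = τ₁}`; the segment stays in
`U ⊇ {x⁰ > τ₀}` (structure field). -/
theorem firstContact_N0 (hN : d.N = 0)
    (hd : ∀ y : d.flatDomain, d.τ₀ < y.1 0 →
      𝓢.timeOrientation.IsFutureDirected (mfderiv 𝓘(ℝ, E4) (𝓡 4) d.flatChart y (E4.basisVector 0)))
    (τ₁ : ℝ) (y : d.flatDomain) (hy₀ : d.τ₀ < y.1 0) (hy₁ : y.1 0 ≤ τ₁) :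
    d.flatChart y ∈ 𝓢.metric.causalPast 𝓢.timeOrientation
        (d.flatChart '' (Minkowski.backgroundOn d.flatDomain).timeSlab τ₁) ∨
      ∃ (c : d.flatDomain) (k : Fin d.N), d.τ₀ < c.1 0 ∧ c.1 0 ≤ τ₁ ∧
        (d.background k).radius c.1 ≤ R k ((d.background k).time c.1) ∧
        d.flatChart y ∈ 𝓢.metric.causalPast 𝓢.timeOrientation {d.flatChart c} := by
  left
  set s := τ₁ - y.1 0 with hs
  have hs0 : 0 ≤ s := by rw [hs]; linarith
  set ε := (y.1 0 - d.τ₀) / 2 with hεdef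
  have hε : 0 < ε := by rw [hεdef]; linarith
  have hmem : ∀ σ ∈ Icc (-ε) (s + ε), y.1 + σ • E4.basisVector 0 ∈ d.flatDomain := by
    intro σ hσ
    apply d.setOf_lt_excision_subset_flatDomain
    refine ⟨?_, fun i ↦ (Fin.cast hN i).elim0⟩
    show d.τ₀ < (y.1 + σ • E4.basisVector 0) 0
    have h1 : -ε ≤ σ := hσ.1
    rw [coord0_add_smul_e₀]
    linarith
  have hflow := line_mem_causalFuture d.isLateChart_flat.contMDiff (E4.basisVector 0) y.1 y.2 hs0 hε
    hmem (by
      rintro z ⟨σ, hσ, hzσ⟩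
      apply hd
      show d.τ₀ < z.1 0
      rw [← hzσ]
      have h1 : 0 ≤ σ := hσ.1
      show d.τ₀ < (y.1 + σ • E4.basisVector 0) 0
      rw [coord0_add_smul_e₀]
      linarith)
  have hz : (⟨y.1 + s • E4.basisVector 0, hmem s ⟨by linarith, by linarith⟩⟩ : d.flatDomain) ∈
      (Minkowski.backgroundOn d.flatDomain).timeSlab τ₁ := by
    show (y.1 + s • E4.basisVector 0) 0 = τ₁
    rw [coord0_add_smul_e₀, hs]
    ring
  have hzS : d.flatChart ⟨y.1 + s • E4.basisVector 0, hmem s ⟨by linarith, by linarith⟩⟩ ∈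
      d.flatChart '' (Minkowski.backgroundOn d.flatDomain).timeSlab τ₁ :=
    ⟨_, hz, rfl⟩
  exact LorentzianMetric.causalFuture_mono (singleton_subset_iff.mpr hzS)
    (LorentzianMetric.mem_causalPast_of_mem_causalFuture hflow)

/-- STUB 2 at `N = 0` in every spacetime, from SEAMED (11) and the slab convention alone: a point of
`closure F₀ \ F₀` is by (11) a flat point with `y⁰ ≥ τ₁` (no wall: no hole), and `y⁰ > τ₁` would put
it in `F₀`, so it lies on the flat slab. -/
theorem rim_N0 (hN : d.N = 0)
    (h11 : ∀ τ' : ℝ, d.τ₀ < τ' → closure (d.flatChart '' {y | τ' ≤ y.1 0}) ⊆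
      d.flatChart '' {y | τ' ≤ y.1 0} ∪
        ⋃ j, d.chart j '' {x | τ' ≤ x.1 0 ∧ (d.background j).radius x.1 = d.excision j (x.1 0)})
    (τ₁ : ℝ) (hτ₁ : d.τ₀ < τ₁) :
    (closure (certifiedLate d R τ₁) ∩ O) \ certifiedLate d R τ₁ ⊆
      certifiedSlab d R τ₁ ∪ rideable d R R₀ τ₁ := by
  haveI : IsEmpty (Fin d.N) := ⟨fun i ↦ (Fin.cast hN i).elim0⟩
  rintro z ⟨⟨hzcl, -⟩, hzF⟩
  have hF : certifiedLate d R τ₁ = d.flatChart '' (Minkowski.backgroundOn d.flatDomain).lateRegion τ₁ := by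
    rw [certifiedLate, Set.iUnion_of_empty, Set.union_empty]
  rw [hF] at hzcl hzF
  have hsub : d.flatChart '' (Minkowski.backgroundOn d.flatDomain).lateRegion τ₁ ⊆
      d.flatChart '' {y | τ₁ ≤ y.1 0} := by
    rintro _ ⟨y, hy, rfl⟩
    exact ⟨y, le_of_lt (show τ₁ < y.1 0 from hy), rfl⟩
  have h := h11 τ₁ hτ₁ (closure_mono hsub hzcl)
  rw [Set.iUnion_of_empty, Set.union_empty] at h
  obtain ⟨y, hy, rfl⟩ := h
  have hy' : y.1 0 = τ₁ := by
    rcases (show τ₁ ≤ y.1 0 from hy).eq_or_lt with h | h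
    · exact h.symm
    · exact absurd ⟨y, h, rfl⟩ hzF
  exact Or.inl (Or.inl ⟨y, hy', rfl⟩)

end NZero

end Summit.FinalStateConjecture.FinalStateConjecture.Cruxes.SeamedChartsExhaust.WideAnchoring

end
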